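import Literature.Computability.Complexity.HardcoreInapproximabilityPlanted
import Literature.Computability.Complexity.HardcoreInapproximabilityPlantedAsymptotics
import Literature.Computability.Complexity.HardcoreInapproximabilityTransfer
import Literature.Computability.Complexity.HardcoreInapproximabilityFirstMomentCount
import Literature.Computability.Complexity.HardcoreInapproximabilityCycleMoments
import HarnessLib

/-!
# Sly (2010), Lemma 3.8 — the planted lower bound on the cycle-count factorial moments

Hypothesis (P) of the small-subgraph-conditioning bound for `Y = Z_{a,b}(η)` and the short cycle
counts of the configuration-type core: for slices in a `χ`-window around the reference densities
`(p⁺, p⁻)` and `n ≥ n₀`, uniformly in `m' ≤ n^{1/10}`, the boundary `η` and the orders `m ≤ B`,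
`(1-ε) (Σ_ω Z_{a,b}) Π_i ((q^{2(i+1)}+q)(1+r^{i+1}))^{m_i} ≤ Σ_ω Z_{a,b}(ω) Π_i DT_i(ω)`,
`r = p⁺p⁻/((1-p⁺)(1-p⁻))` (`sly_planted_lower`; counting form `sum_slyZab_mul_prod_ge`).
Only the lower bound is needed, so only vertex-disjoint planted families enter (exchange inequality
`sum_famDisjoint_planted_le`); per family the planted count in trace form (`slyPlantedN`,
`HardcoreInapproximabilityPlanted`) is bounded below colour by colour (`planted_ratio_ge`,
`slyColourLimit_ge_ref`, `slyPlantedN_div_ge`), the trace counts by `traceCount_ge_ref`, the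
constants collapse to Sly's transfer constants (`trace_colour_eq_transfer`) and the trace sum
evaluates to `Π_i (1+r^{i+1})^{m_i}` (`sum_feasTr_transfer`, via `slyCycleSum_identity`).

## References
* [Sly2010] A. Sly, *Computational transition at the uniqueness threshold*, FOCS 2010,
  arXiv:1005.5584, Lemma 3.8.
* [MosselWeitzWormald2008] E. Mossel, D. Weitz, N. Wormald, *On the hardness of sampling
  independent sets beyond the tree threshold*, PTRF 143 (2009), Lemmas 7.4, 7.5.
-/

namespace Literature.Computability.Complexity

open Finset Real

section SlotCounts

variable {n q k : ℕ} {mv : Fin k → ℕ}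

/-- All edge slots of a family. [folklore] -/
abbrev SlyFamEdges (k : ℕ) (mv : Fin k → ℕ) : Type :=
  Σ i : Fin k, Fin (mv i) × (Fin ((i : ℕ) + 1) ⊕ Fin ((i : ℕ) + 1))

/-- The plus slot of an edge slot. [folklore] -/
def slyPlusSlot' {k : ℕ} {mv : Fin k → ℕ} (p : SlyFamEdges k mv) : Σ i : Fin k, Fin (mv i) × Fin ((i : ℕ) + 1) :=
  ⟨p.1, p.2.1, slyPlusIdx _ p.2.2⟩

/-- The minus slot of an edge slot. [folklore] -/
def slyMinusSlot' {k : ℕ} {mv : Fin k → ℕ} (p : SlyFamEdges k mv) : Σ i : Fin k, Fin (mv i) × Fin ((i : ℕ) + 1) :=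
  ⟨p.1, p.2.1, slyMinusIdx _ p.2.2⟩

/-- **The colour classes partition the `2J` edge slots.** [folklore] -/
theorem sum_card_slyFamEdgesOf (F : (i : Fin k) → Fin (mv i) → SlyWCycle n q ((i : ℕ) + 1)) :
    ∑ c : Option (Fin q), Fintype.card (SlyFamEdgesOf F c) = 2 * slyFamJ mv := by
  classical
  have h : ∑ c : Option (Fin q), Fintype.card (SlyFamEdgesOf F c) = Fintype.card (SlyFamEdges k mv) := by
    rw [← Fintype.card_sigma]
    exact Fintype.card_congr (Equiv.sigmaFiberEquiv fun p : SlyFamEdges k mv => (F p.1 p.2.1).colour p.2.2)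
  rw [h, Fintype.card_sigma]
  unfold slyFamJ
  rw [Finset.mul_sum]
  refine Finset.sum_congr rfl fun i _ => ?_
  simp only [Fintype.card_prod, Fintype.card_sum, Fintype.card_fin]
  ring

/-- `f⁺_c(χ)` as a filter of all edge slots. [folklore] -/
theorem slyFplus_eq_card_filter (F : (i : Fin k) → Fin (mv i) → SlyWCycle n q ((i : ℕ) + 1)) (c : Option (Fin q))
    (χ : Finset (Σ i : Fin k, Fin (mv i) × Fin ((i : ℕ) + 1))) :
    slyFplus F c χ = ((univ : Finset (SlyFamEdges k mv)).filter fun p =>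
      (F p.1 p.2.1).colour p.2.2 = c ∧ slyPlusSlot' p ∈ χ).card := by
  classical
  unfold slyFplus
  rw [← Finset.card_map (Function.Embedding.subtype _)]
  congr 1
  ext p
  simp only [Finset.mem_map, Finset.mem_filter, Finset.mem_univ, true_and, Function.Embedding.coe_subtype]
  constructor
  · rintro ⟨p', hp', rfl⟩
    exact ⟨p'.2, hp'⟩
  · rintro ⟨hc, hχ⟩
    exact ⟨⟨p, hc⟩, hχ, rfl⟩

/-- `f⁻_c(χ)` as a filter of all edge slots. [folklore] -/
theorem slyFminus_eq_card_filter (F : (i : Fin k) → Fin (mv i) → SlyWCycle n q ((i : ℕ) + 1)) (c : Option (Fin q))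
    (χ : Finset (Σ i : Fin k, Fin (mv i) × Fin ((i : ℕ) + 1))) :
    slyFminus F c χ = ((univ : Finset (SlyFamEdges k mv)).filter fun p =>
      (F p.1 p.2.1).colour p.2.2 = c ∧ slyMinusSlot' p ∈ χ).card := by
  classical
  unfold slyFminus
  rw [← Finset.card_map (Function.Embedding.subtype _)]
  congr 1
  ext p
  simp only [Finset.mem_map, Finset.mem_filter, Finset.mem_univ, true_and, Function.Embedding.coe_subtype]
  constructor
  · rintro ⟨p', hp', rfl⟩
    exact ⟨p'.2, hp'⟩
  · rintro ⟨hc, hχ⟩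
    exact ⟨⟨p, hc⟩, hχ, rfl⟩

/-- **Every slot is the plus end of exactly two edges**: `Σ_c f⁺_c(χ) = 2|χ|`. [folklore] -/
theorem sum_slyFplus (F : (i : Fin k) → Fin (mv i) → SlyWCycle n q ((i : ℕ) + 1))
    (χ : Finset (Σ i : Fin k, Fin (mv i) × Fin ((i : ℕ) + 1))) :
    ∑ c : Option (Fin q), slyFplus F c χ = 2 * χ.card := by
  classical
  simp_rw [slyFplus_eq_card_filter]
  -- fibrewise over the colour
  have h1 : ∑ c : Option (Fin q), ((univ : Finset (SlyFamEdges k mv)).filter fun p =>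
      (F p.1 p.2.1).colour p.2.2 = c ∧ slyPlusSlot' p ∈ χ).card =
      ((univ : Finset (SlyFamEdges k mv)).filter fun p => slyPlusSlot' p ∈ χ).card := by
    rw [Finset.card_eq_sum_card_fiberwise (f := fun p : SlyFamEdges k mv => (F p.1 p.2.1).colour p.2.2)
      (t := (univ : Finset (Option (Fin q)))) (fun _ _ => Finset.mem_univ _)]
    refine Finset.sum_congr rfl fun c _ => ?_
    congr 1
    ext p
    simp only [Finset.mem_filter, Finset.mem_univ, true_and]
    tauto
  have hχ : χ.card = ∑ s : (Σ i : Fin k, Fin (mv i) × Fin ((i : ℕ) + 1)), (if s ∈ χ then 1 else 0) := by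
    rw [← Finset.card_filter]
    congr 1; ext s; simp
  rw [h1, Finset.card_filter, hχ, Fintype.sum_sigma, Fintype.sum_sigma, Finset.mul_sum]
  refine Finset.sum_congr rfl fun i _ => ?_
  rw [Fintype.sum_prod_type, Fintype.sum_prod_type, Finset.mul_sum]
  refine Finset.sum_congr rfl fun a _ => ?_
  rw [Fintype.sum_sum_type]
  have hrot : ∑ t : Fin ((i : ℕ) + 1), (if slyPlusSlot' (⟨i, a, Sum.inr t⟩ : SlyFamEdges k mv) ∈ χ then 1 else 0) =
      ∑ t : Fin ((i : ℕ) + 1), (if ((⟨i, (a, t)⟩ : Σ i : Fin k, Fin (mv i) × Fin ((i : ℕ) + 1)) ∈ χ) then 1 else 0) :=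
    Equiv.sum_comp (finRotate ((i : ℕ) + 1))
      (fun t => if ((⟨i, (a, t)⟩ : Σ i : Fin k, Fin (mv i) × Fin ((i : ℕ) + 1)) ∈ χ) then 1 else 0)
  have hinl : ∑ t : Fin ((i : ℕ) + 1), (if slyPlusSlot' (⟨i, a, Sum.inl t⟩ : SlyFamEdges k mv) ∈ χ then 1 else 0) =
      ∑ t : Fin ((i : ℕ) + 1), (if ((⟨i, (a, t)⟩ : Σ i : Fin k, Fin (mv i) × Fin ((i : ℕ) + 1)) ∈ χ) then 1 else 0) := rfl
  rw [hinl, hrot, two_mul]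

/-- **Every slot is the minus end of exactly two edges**: `Σ_c f⁻_c(χ) = 2|χ|`. [folklore] -/
theorem sum_slyFminus (F : (i : Fin k) → Fin (mv i) → SlyWCycle n q ((i : ℕ) + 1))
    (χ : Finset (Σ i : Fin k, Fin (mv i) × Fin ((i : ℕ) + 1))) :
    ∑ c : Option (Fin q), slyFminus F c χ = 2 * χ.card := by
  classical
  simp_rw [slyFminus_eq_card_filter]
  have h1 : ∑ c : Option (Fin q), ((univ : Finset (SlyFamEdges k mv)).filter fun p =>
      (F p.1 p.2.1).colour p.2.2 = c ∧ slyMinusSlot' p ∈ χ).card =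
      ((univ : Finset (SlyFamEdges k mv)).filter fun p => slyMinusSlot' p ∈ χ).card := by
    rw [Finset.card_eq_sum_card_fiberwise (f := fun p : SlyFamEdges k mv => (F p.1 p.2.1).colour p.2.2)
      (t := (univ : Finset (Option (Fin q)))) (fun _ _ => Finset.mem_univ _)]
    refine Finset.sum_congr rfl fun c _ => ?_
    congr 1
    ext p
    simp only [Finset.mem_filter, Finset.mem_univ, true_and]
    tauto
  have hχ : χ.card = ∑ s : (Σ i : Fin k, Fin (mv i) × Fin ((i : ℕ) + 1)), (if s ∈ χ then 1 else 0) := by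
    rw [← Finset.card_filter]
    congr 1; ext s; simp
  rw [h1, Finset.card_filter, hχ, Fintype.sum_sigma, Fintype.sum_sigma, Finset.mul_sum]
  refine Finset.sum_congr rfl fun i _ => ?_
  rw [Fintype.sum_prod_type, Fintype.sum_prod_type, Finset.mul_sum]
  refine Finset.sum_congr rfl fun a _ => ?_
  rw [Fintype.sum_sum_type]
  have hinl : ∑ t : Fin ((i : ℕ) + 1), (if slyMinusSlot' (⟨i, a, Sum.inl t⟩ : SlyFamEdges k mv) ∈ χ then 1 else 0) =
      ∑ t : Fin ((i : ℕ) + 1), (if ((⟨i, (a, t)⟩ : Σ i : Fin k, Fin (mv i) × Fin ((i : ℕ) + 1)) ∈ χ) then 1 else 0) := rfl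
  have hinr : ∑ t : Fin ((i : ℕ) + 1), (if slyMinusSlot' (⟨i, a, Sum.inr t⟩ : SlyFamEdges k mv) ∈ χ then 1 else 0) =
      ∑ t : Fin ((i : ℕ) + 1), (if ((⟨i, (a, t)⟩ : Σ i : Fin k, Fin (mv i) × Fin ((i : ℕ) + 1)) ∈ χ) then 1 else 0) := rfl
  rw [hinl, hinr, two_mul]

end SlotCounts

section ColourLowerBound

/-- `|log u - log v| ≤ |u - v|/m₀` for `u, v ≥ m₀ > 0`. [folklore] -/
private theorem abs_log_sub_log_le_pl {u v m₀ : ℝ} (hm : 0 < m₀) (hu : m₀ ≤ u) (hv : m₀ ≤ v) :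
    |Real.log u - Real.log v| ≤ |u - v| / m₀ := by
  have hu0 : 0 < u := lt_of_lt_of_le hm hu
  have hv0 : 0 < v := lt_of_lt_of_le hm hv
  rw [abs_le]
  constructor
  · have h1 : Real.log v - Real.log u ≤ (v - u) / u := by
      rw [← Real.log_div hv0.ne' hu0.ne']
      have := Real.log_le_sub_one_of_pos (div_pos hv0 hu0)
      rwa [div_sub_one hu0.ne'] at this
    have h2 : (v - u) / u ≤ |u - v| / m₀ := by
      rw [div_le_div_iff₀ hu0 hm]
      have : v - u ≤ |u - v| := by rw [abs_sub_comm]; exact le_abs_self _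
      nlinarith [abs_nonneg (u - v)]
    linarith
  · have h1 : Real.log u - Real.log v ≤ (u - v) / v := by
      rw [← Real.log_div hu0.ne' hv0.ne']
      have := Real.log_le_sub_one_of_pos (div_pos hu0 hv0)
      rwa [div_sub_one hv0.ne'] at this
    have h2 : (u - v) / v ≤ |u - v| / m₀ := by
      rw [div_le_div_iff₀ hv0 hm]
      have : u - v ≤ |u - v| := le_abs_self _
      nlinarith [abs_nonneg (u - v)]
    linarith

/-- **Powers under a log perturbation**: `y^e · exp(-e η) ≤ x^e` when `|log x - log y| ≤ η`. [folklore] -/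
theorem pow_mul_exp_neg_le_pow {x y η : ℝ} (hx : 0 < x) (hy : 0 < y) (h : |Real.log x - Real.log y| ≤ η) (e : ℕ) :
    y ^ e * Real.exp (-(e * η)) ≤ x ^ e := by
  have hxe : x ^ e = Real.exp (e * Real.log x) := by
    rw [← Real.rpow_natCast, Real.rpow_def_of_pos hx, mul_comm]
  have hye : y ^ e = Real.exp (e * Real.log y) := by
    rw [← Real.rpow_natCast, Real.rpow_def_of_pos hy, mul_comm]
  rw [hxe, hye, ← Real.exp_add]
  refine Real.exp_le_exp.2 ?_
  have h1 : Real.log y - η ≤ Real.log x := by have := (abs_le.1 h).1; linarith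
  have he : (0 : ℝ) ≤ e := Nat.cast_nonneg e
  nlinarith

/-- **Per-colour planted ratio, multiplicative lower bound** (Sly's `P2 ≥ (1-o(1)) P3 · limit / N^e`):
`[C(N-b',a')/C(N,a')] · L · exp(-(32e²/m + 2e²/N)) / N^e ≤ [C(N-e-(b'-f⁻), a'-f⁺)/C(N-e, a'-f⁺)] / N^{(e)}`,
`L = slyColourLimit (a'/N) (b'/N) e f⁺ f⁻`, `m = min(a', N-a'-b')`. [cite: Sly2010, Lemma 3.8 (proof: `P1`, `P2/P3`)] -/
theorem planted_ratio_ge (N e fp fm a' b' : ℕ) (hfp : fp ≤ e) (hfm : fm ≤ e) (hfmb : fm ≤ b')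
    (ha0 : 0 < a') (ha : 4 * e ≤ a') (hgap : 4 * e ≤ N - a' - b') (hab : a' + b' < N) :
    (((N - b').choose a' : ℕ) : ℝ) / ((N.choose a' : ℕ) : ℝ) *
        slyColourLimit ((a' : ℝ) / N) ((b' : ℝ) / N) e fp fm *
        Real.exp (-(32 * (e : ℝ) ^ 2 / min (a' : ℝ) ((N : ℝ) - a' - b') + 2 * (e : ℝ) ^ 2 / N)) / (N : ℝ) ^ e ≤
      (((N - e - (b' - fm)).choose (a' - fp) : ℕ) : ℝ) / (((N - e).choose (a' - fp) : ℕ) : ℝ) /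
        (N.descFactorial e : ℝ) := by
  have h := planted_colour_logratio N e fp fm a' b' hfp hfm hfmb ha0 ha hgap hab
  have hN0 : 0 < N := by omega
  have hNr : (0 : ℝ) < N := by exact_mod_cast hN0
  have hdesc := abs_log_descFactorial_sub_le N e hN0 (by omega)
  have hC1 : (0 : ℝ) < (((N - e - (b' - fm)).choose (a' - fp) : ℕ) : ℝ) := by
    exact_mod_cast Nat.choose_pos (by omega)
  have hC2 : (0 : ℝ) < (((N - e).choose (a' - fp) : ℕ) : ℝ) := by exact_mod_cast Nat.choose_pos (by omega)
  have hC3 : (0 : ℝ) < (((N - b').choose a' : ℕ) : ℝ) := by exact_mod_cast Nat.choose_pos (by omega)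
  have hC4 : (0 : ℝ) < ((N.choose a' : ℕ) : ℝ) := by exact_mod_cast Nat.choose_pos (by omega)
  have hD : (0 : ℝ) < (N.descFactorial e : ℝ) := by exact_mod_cast Nat.descFactorial_pos.2 (by omega)
  have hα : (a' : ℝ) / N < 1 := by rw [div_lt_one hNr]; exact_mod_cast (show a' < N by omega)
  have hβ : (b' : ℝ) / N < 1 := by rw [div_lt_one hNr]; exact_mod_cast (show b' < N by omega)
  have hαβ : (a' : ℝ) / N + (b' : ℝ) / N < 1 := by
    rw [← add_div, div_lt_one hNr]; exact_mod_cast hab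
  have hL : 0 < slyColourLimit ((a' : ℝ) / N) ((b' : ℝ) / N) e fp fm := by
    unfold slyColourLimit
    have h1 : 0 < 1 - (a' : ℝ) / N - (b' : ℝ) / N := by linarith
    have h2 := sub_pos.2 hα
    have h3 := sub_pos.2 hβ
    positivity
  have hNe : (N : ℝ) ^ e = Real.exp (e * Real.log N) := by
    rw [← Real.rpow_natCast, Real.rpow_def_of_pos hNr, mul_comm]
  have eqR : (((N - e - (b' - fm)).choose (a' - fp) : ℕ) : ℝ) / (((N - e).choose (a' - fp) : ℕ) : ℝ) / (N.descFactorial e : ℝ) =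
      Real.exp (Real.log (((N - e - (b' - fm)).choose (a' - fp) : ℕ) : ℝ) - Real.log (((N - e).choose (a' - fp) : ℕ) : ℝ) -
        Real.log (N.descFactorial e : ℝ)) := by
    rw [Real.exp_sub, Real.exp_sub, Real.exp_log hC1, Real.exp_log hC2, Real.exp_log hD]
  have eqL : (((N - b').choose a' : ℕ) : ℝ) / ((N.choose a' : ℕ) : ℝ) *
        slyColourLimit ((a' : ℝ) / N) ((b' : ℝ) / N) e fp fm *
        Real.exp (-(32 * (e : ℝ) ^ 2 / min (a' : ℝ) ((N : ℝ) - a' - b') + 2 * (e : ℝ) ^ 2 / N)) / (N : ℝ) ^ e =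
      Real.exp ((Real.log (((N - b').choose a' : ℕ) : ℝ) - Real.log ((N.choose a' : ℕ) : ℝ)) +
        Real.log (slyColourLimit ((a' : ℝ) / N) ((b' : ℝ) / N) e fp fm) +
        (-(32 * (e : ℝ) ^ 2 / min (a' : ℝ) ((N : ℝ) - a' - b') + 2 * (e : ℝ) ^ 2 / N)) - e * Real.log N) := by
    rw [Real.exp_sub, Real.exp_add, Real.exp_add, Real.exp_sub, Real.exp_log hC3, Real.exp_log hC4, Real.exp_log hL, hNe]
  rw [eqR, eqL]
  refine Real.exp_le_exp.2 ?_
  have h1 := (abs_le.1 h).1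
  have h2 := (abs_le.1 hdesc).2
  linarith

/-- The three per-colour bases: `A = (1-α-β)/((1-α)(1-β))`. [cite: Sly2010, Lemma 3.8 (proof)] -/
noncomputable def slyCA (α β : ℝ) : ℝ := (1 - α - β) / ((1 - α) * (1 - β))

/-- `B = (1-α)/(1-α-β)`. [cite: Sly2010, Lemma 3.8 (proof)] -/
noncomputable def slyCB (α β : ℝ) : ℝ := (1 - α) / (1 - α - β)

/-- `C = (1-β)/(1-α-β)`. [cite: Sly2010, Lemma 3.8 (proof)] -/
noncomputable def slyCC (α β : ℝ) : ℝ := (1 - β) / (1 - α - β)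

/-- `slyColourLimit α β e f⁺ f⁻ = A^e B^{f⁺} C^{f⁻}`. [folklore] -/
theorem slyColourLimit_eq_ABC {α β : ℝ} (hα : α < 1) (hβ : β < 1) (hαβ : α + β < 1) (e fp fm : ℕ) :
    slyColourLimit α β e fp fm = slyCA α β ^ e * slyCB α β ^ fp * slyCC α β ^ fm := by
  unfold slyColourLimit slyCA slyCB slyCC
  have h1 : (1 - α) ≠ 0 := ne_of_gt (sub_pos.2 hα)
  have h2 : (1 - β) ≠ 0 := ne_of_gt (sub_pos.2 hβ)
  have h3 : (1 - α - β) ≠ 0 := ne_of_gt (by linarith)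
  rw [div_pow, div_pow, div_pow, mul_pow, pow_add]
  field_simp

/-- Positivity of the bases. [folklore] -/
theorem slyCA_pos {α β : ℝ} (hα : α < 1) (hβ : β < 1) (hαβ : α + β < 1) : 0 < slyCA α β := by
  unfold slyCA; have := sub_pos.2 hα; have := sub_pos.2 hβ; have : 0 < 1 - α - β := by linarith
  positivity

/-- Positivity of the bases. [folklore] -/
theorem slyCB_pos {α β : ℝ} (hα : α < 1) (hαβ : α + β < 1) : 0 < slyCB α β := by
  unfold slyCB; have := sub_pos.2 hα; have : 0 < 1 - α - β := by linarith
  positivity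

/-- Positivity of the bases. [folklore] -/
theorem slyCC_pos {α β : ℝ} (hβ : β < 1) (hαβ : α + β < 1) : 0 < slyCC α β := by
  unfold slyCC; have := sub_pos.2 hβ; have : 0 < 1 - α - β := by linarith
  positivity

/-- **Log-Lipschitz control of the bases in the densities**: if `|α-α₀|, |β-β₀| ≤ D`, all of
`α, β, α₀, β₀ ≥ 0` and `m ≤ 1-α-β`, `m ≤ 1-α₀-β₀` (`m > 0`), then `|log A(α,β) - log A(α₀,β₀)| ≤ 4D/m`,
and the same for `B`, `C`. [folklore] -/
theorem abs_log_slyCA_sub_le {α β α₀ β₀ D m : ℝ} (hm : 0 < m) (ha : 0 ≤ α) (hb : 0 ≤ β) (ha₀ : 0 ≤ α₀) (hb₀ : 0 ≤ β₀)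
    (hg : m ≤ 1 - α - β) (hg₀ : m ≤ 1 - α₀ - β₀) (hDa : |α - α₀| ≤ D) (hDb : |β - β₀| ≤ D) :
    |Real.log (slyCA α β) - Real.log (slyCA α₀ β₀)| ≤ 4 * D / m ∧
      |Real.log (slyCB α β) - Real.log (slyCB α₀ β₀)| ≤ 4 * D / m ∧
        |Real.log (slyCC α β) - Real.log (slyCC α₀ β₀)| ≤ 4 * D / m := by
  have hD : 0 ≤ D := le_trans (abs_nonneg _) hDa
  have e1 : m ≤ 1 - α := by linarith
  have e2 : m ≤ 1 - β := by linarith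
  have e3 : m ≤ 1 - α₀ := by linarith
  have e4 : m ≤ 1 - β₀ := by linarith
  have p1 : 0 < 1 - α := by linarith
  have p2 : 0 < 1 - β := by linarith
  have p3 : 0 < 1 - α₀ := by linarith
  have p4 : 0 < 1 - β₀ := by linarith
  have p5 : 0 < 1 - α - β := by linarith
  have p6 : 0 < 1 - α₀ - β₀ := by linarith
  -- the three elementary deviations
  have dA : |Real.log (1 - α) - Real.log (1 - α₀)| ≤ D / m := by
    refine le_trans (abs_log_sub_log_le_pl hm e1 e3) (div_le_div_of_nonneg_right ?_ hm.le)
    rw [show (1 - α) - (1 - α₀) = -(α - α₀) by ring, abs_neg]; exact hDa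
  have dB : |Real.log (1 - β) - Real.log (1 - β₀)| ≤ D / m := by
    refine le_trans (abs_log_sub_log_le_pl hm e2 e4) (div_le_div_of_nonneg_right ?_ hm.le)
    rw [show (1 - β) - (1 - β₀) = -(β - β₀) by ring, abs_neg]; exact hDb
  have dG : |Real.log (1 - α - β) - Real.log (1 - α₀ - β₀)| ≤ 2 * D / m := by
    refine le_trans (abs_log_sub_log_le_pl hm hg hg₀) ?_
    rw [div_le_div_iff₀ hm hm]
    have : |(1 - α - β) - (1 - α₀ - β₀)| ≤ 2 * D := by
      rw [show (1 - α - β) - (1 - α₀ - β₀) = -((α - α₀) + (β - β₀)) by ring, abs_neg]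
      exact le_trans (abs_add_le _ _) (by linarith)
    nlinarith
  have lA : Real.log (slyCA α β) - Real.log (slyCA α₀ β₀) =
      (Real.log (1 - α - β) - Real.log (1 - α₀ - β₀)) - (Real.log (1 - α) - Real.log (1 - α₀)) -
        (Real.log (1 - β) - Real.log (1 - β₀)) := by
    unfold slyCA
    rw [Real.log_div p5.ne' (mul_pos p1 p2).ne', Real.log_div p6.ne' (mul_pos p3 p4).ne',
      Real.log_mul p1.ne' p2.ne', Real.log_mul p3.ne' p4.ne']
    ring
  have lB : Real.log (slyCB α β) - Real.log (slyCB α₀ β₀) =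
      (Real.log (1 - α) - Real.log (1 - α₀)) - (Real.log (1 - α - β) - Real.log (1 - α₀ - β₀)) := by
    unfold slyCB
    rw [Real.log_div p1.ne' p5.ne', Real.log_div p3.ne' p6.ne']
    ring
  have lC : Real.log (slyCC α β) - Real.log (slyCC α₀ β₀) =
      (Real.log (1 - β) - Real.log (1 - β₀)) - (Real.log (1 - α - β) - Real.log (1 - α₀ - β₀)) := by
    unfold slyCC
    rw [Real.log_div p2.ne' p5.ne', Real.log_div p4.ne' p6.ne']
    ring
  have hDm : 0 ≤ D / m := div_nonneg hD hm.le
  refine ⟨?_, ?_, ?_⟩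
  · rw [lA]
    calc _ ≤ |Real.log (1 - α - β) - Real.log (1 - α₀ - β₀)| + |Real.log (1 - α) - Real.log (1 - α₀)| +
          |Real.log (1 - β) - Real.log (1 - β₀)| := by
            have t1 := abs_sub (Real.log (1 - α - β) - Real.log (1 - α₀ - β₀) - (Real.log (1 - α) - Real.log (1 - α₀)))
              (Real.log (1 - β) - Real.log (1 - β₀))
            have t2 := abs_sub (Real.log (1 - α - β) - Real.log (1 - α₀ - β₀)) (Real.log (1 - α) - Real.log (1 - α₀))
            linarith
      _ ≤ 2 * D / m + D / m + D / m := by linarith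
      _ = 4 * D / m := by ring
  · rw [lB]
    calc _ ≤ |Real.log (1 - α) - Real.log (1 - α₀)| + |Real.log (1 - α - β) - Real.log (1 - α₀ - β₀)| := abs_sub _ _
      _ ≤ D / m + 2 * D / m := by linarith
      _ ≤ 4 * D / m := by
          rw [show D / m + 2 * D / m = 3 * D / m by ring]; exact div_le_div_of_nonneg_right (by linarith) hm.le
  · rw [lC]
    calc _ ≤ |Real.log (1 - β) - Real.log (1 - β₀)| + |Real.log (1 - α - β) - Real.log (1 - α₀ - β₀)| := abs_sub _ _
      _ ≤ D / m + 2 * D / m := by linarith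
      _ ≤ 4 * D / m := by
          rw [show D / m + 2 * D / m = 3 * D / m by ring]; exact div_le_div_of_nonneg_right (by linarith) hm.le

/-- **The colour limit at perturbed densities dominates the one at the reference densities** up to
`exp(-3e · η)`: `A₀^e B₀^{f⁺} C₀^{f⁻} exp(-(3e) η) ≤ slyColourLimit α β e f⁺ f⁻` (`f⁺, f⁻ ≤ e`,
`η = 4D/m`). [folklore] -/
theorem slyColourLimit_ge_ref {α β α₀ β₀ D m : ℝ} (hm : 0 < m) (ha : 0 ≤ α) (hb : 0 ≤ β) (ha₀ : 0 ≤ α₀) (hb₀ : 0 ≤ β₀)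
    (hg : m ≤ 1 - α - β) (hg₀ : m ≤ 1 - α₀ - β₀) (hDa : |α - α₀| ≤ D) (hDb : |β - β₀| ≤ D)
    {e fp fm : ℕ} (hfp : fp ≤ e) (hfm : fm ≤ e) :
    slyCA α₀ β₀ ^ e * slyCB α₀ β₀ ^ fp * slyCC α₀ β₀ ^ fm * Real.exp (-(3 * e * (4 * D / m))) ≤
      slyColourLimit α β e fp fm := by
  have hD : 0 ≤ D := le_trans (abs_nonneg _) hDa
  have hα : α < 1 := by linarith
  have hβ : β < 1 := by linarith
  have hαβ : α + β < 1 := by linarith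
  have hα₀ : α₀ < 1 := by linarith
  have hβ₀ : β₀ < 1 := by linarith
  have hαβ₀ : α₀ + β₀ < 1 := by linarith
  obtain ⟨dA, dB, dC⟩ := abs_log_slyCA_sub_le hm ha hb ha₀ hb₀ hg hg₀ hDa hDb
  rw [slyColourLimit_eq_ABC hα hβ hαβ]
  have pA := slyCA_pos hα hβ hαβ; have pB := slyCB_pos hα hαβ; have pC := slyCC_pos hβ hαβ
  have pA₀ := slyCA_pos hα₀ hβ₀ hαβ₀; have pB₀ := slyCB_pos hα₀ hαβ₀; have pC₀ := slyCC_pos hβ₀ hαβ₀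
  have iA := pow_mul_exp_neg_le_pow pA pA₀ dA e
  have iB := pow_mul_exp_neg_le_pow pB pB₀ dB fp
  have iC := pow_mul_exp_neg_le_pow pC pC₀ dC fm
  have hη : 0 ≤ 4 * D / m := div_nonneg (by linarith) hm.le
  -- collect the three exponentials: their product dominates `exp(-3eη)`
  have hexp : Real.exp (-(3 * e * (4 * D / m))) ≤
      Real.exp (-(e * (4 * D / m))) * Real.exp (-(fp * (4 * D / m))) * Real.exp (-(fm * (4 * D / m))) := by
    rw [← Real.exp_add, ← Real.exp_add]
    refine Real.exp_le_exp.2 ?_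
    have h1 : (fp : ℝ) ≤ e := by exact_mod_cast hfp
    have h2 : (fm : ℝ) ≤ e := by exact_mod_cast hfm
    nlinarith
  calc slyCA α₀ β₀ ^ e * slyCB α₀ β₀ ^ fp * slyCC α₀ β₀ ^ fm * Real.exp (-(3 * e * (4 * D / m)))
      ≤ slyCA α₀ β₀ ^ e * slyCB α₀ β₀ ^ fp * slyCC α₀ β₀ ^ fm *
          (Real.exp (-(e * (4 * D / m))) * Real.exp (-(fp * (4 * D / m))) * Real.exp (-(fm * (4 * D / m)))) :=
        mul_le_mul_of_nonneg_left hexp (by positivity)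
    _ = (slyCA α₀ β₀ ^ e * Real.exp (-(e * (4 * D / m)))) * (slyCB α₀ β₀ ^ fp * Real.exp (-(fp * (4 * D / m)))) *
          (slyCC α₀ β₀ ^ fm * Real.exp (-(fm * (4 * D / m)))) := by ring
    _ ≤ slyCA α β ^ e * slyCB α β ^ fp * slyCC α β ^ fm := by
        refine mul_le_mul (mul_le_mul iA iB (by positivity) (by positivity)) iC (by positivity) (by positivity)

/-- **The trace-count factor dominates its reference limit**:
`C(n,a) · α₀^j (1-α₀)^{J-j} · exp(-(16J²/min(a,n-a) + J·D/p + J·D/m)) ≤ C(n-J, a-j)` for `j ≤ J`,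
`|a/n - α₀| ≤ D`, `p ≤ min(a/n, α₀)`, `m ≤ min(1-a/n, 1-α₀)`. [cite: Sly2010, Lemma 3.8 (proof: configurations compatible with `ξ`)] -/
theorem traceCount_ge_ref (n a J j : ℕ) (hj : j ≤ J) (ha0 : 0 < a) (ha : 4 * J ≤ a) (hna : 4 * J ≤ n - a) (han : a < n)
    {α₀ D p m : ℝ} (hp : 0 < p) (hm : 0 < m) (hpa : p ≤ (a : ℝ) / n) (hpα : p ≤ α₀) (hma : m ≤ 1 - (a : ℝ) / n)
    (hmα : m ≤ 1 - α₀) (hD : |(a : ℝ) / n - α₀| ≤ D) :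
    ((n.choose a : ℕ) : ℝ) * (α₀ ^ j * (1 - α₀) ^ (J - j)) *
        Real.exp (-(16 * (J : ℝ) ^ 2 / min (a : ℝ) ((n : ℝ) - a) + J * (D / p) + J * (D / m))) ≤
      (((n - J).choose (a - j) : ℕ) : ℝ) := by
  have h := abs_log_traceCount_sub_le n a J j hj ha0 ha hna han
  have hnr : (0 : ℝ) < n := by exact_mod_cast (show 0 < n by omega)
  have hαpos : 0 < (a : ℝ) / n := lt_of_lt_of_le hp hpa
  have hα1 : 0 < 1 - (a : ℝ) / n := lt_of_lt_of_le hm hma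
  have hα₀ : 0 < α₀ := lt_of_lt_of_le hp hpα
  have hα₀1 : 0 < 1 - α₀ := lt_of_lt_of_le hm hmα
  have hC1 : (0 : ℝ) < (((n - J).choose (a - j) : ℕ) : ℝ) := by exact_mod_cast Nat.choose_pos (by omega)
  have hC2 : (0 : ℝ) < ((n.choose a : ℕ) : ℝ) := by exact_mod_cast Nat.choose_pos (by omega)
  have hDnn : 0 ≤ D := le_trans (abs_nonneg _) hD
  -- log deviations of the two bases
  have d1 : |Real.log ((a : ℝ) / n) - Real.log α₀| ≤ D / p :=
    le_trans (abs_log_sub_log_le_pl hp hpa hpα) (div_le_div_of_nonneg_right hD hp.le)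
  have d2 : |Real.log (1 - (a : ℝ) / n) - Real.log (1 - α₀)| ≤ D / m := by
    refine le_trans (abs_log_sub_log_le_pl hm hma hmα) (div_le_div_of_nonneg_right ?_ hm.le)
    rw [show (1 - (a : ℝ) / n) - (1 - α₀) = -((a : ℝ) / n - α₀) by ring, abs_neg]; exact hD
  have i1 := pow_mul_exp_neg_le_pow hαpos hα₀ d1 j
  have i2 := pow_mul_exp_neg_le_pow hα1 hα₀1 d2 (J - j)
  -- the main factor from the log estimate
  have hmain : ((n.choose a : ℕ) : ℝ) * (((a : ℝ) / n) ^ j * (1 - (a : ℝ) / n) ^ (J - j)) *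
      Real.exp (-(16 * (J : ℝ) ^ 2 / min (a : ℝ) ((n : ℝ) - a))) ≤ (((n - J).choose (a - j) : ℕ) : ℝ) := by
    have hpow : 0 < ((a : ℝ) / n) ^ j * (1 - (a : ℝ) / n) ^ (J - j) := by positivity
    have e1 : ((n.choose a : ℕ) : ℝ) * (((a : ℝ) / n) ^ j * (1 - (a : ℝ) / n) ^ (J - j)) *
        Real.exp (-(16 * (J : ℝ) ^ 2 / min (a : ℝ) ((n : ℝ) - a))) =
        Real.exp (Real.log ((n.choose a : ℕ) : ℝ) + Real.log (((a : ℝ) / n) ^ j * (1 - (a : ℝ) / n) ^ (J - j)) +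
          (-(16 * (J : ℝ) ^ 2 / min (a : ℝ) ((n : ℝ) - a)))) := by
      rw [Real.exp_add, Real.exp_add, Real.exp_log hC2, Real.exp_log hpow]
    have e2 : (((n - J).choose (a - j) : ℕ) : ℝ) = Real.exp (Real.log (((n - J).choose (a - j) : ℕ) : ℝ)) := by
      rw [Real.exp_log hC1]
    rw [e1, e2]
    refine Real.exp_le_exp.2 ?_
    have := (abs_le.1 h).1
    linarith
  -- combine
  have hJj : ((J - j : ℕ) : ℝ) ≤ J := by exact_mod_cast Nat.sub_le J j
  have hjJ : (j : ℝ) ≤ J := by exact_mod_cast hj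
  have hexp : Real.exp (-(16 * (J : ℝ) ^ 2 / min (a : ℝ) ((n : ℝ) - a) + J * (D / p) + J * (D / m))) ≤
      Real.exp (-(16 * (J : ℝ) ^ 2 / min (a : ℝ) ((n : ℝ) - a))) * (Real.exp (-(j * (D / p))) *
        Real.exp (-((J - j : ℕ) * (D / m)))) := by
    rw [← Real.exp_add, ← Real.exp_add]
    refine Real.exp_le_exp.2 ?_
    have h1 : 0 ≤ D / p := div_nonneg hDnn hp.le
    have h2 : 0 ≤ D / m := div_nonneg hDnn hm.le
    nlinarith
  calc ((n.choose a : ℕ) : ℝ) * (α₀ ^ j * (1 - α₀) ^ (J - j)) *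
        Real.exp (-(16 * (J : ℝ) ^ 2 / min (a : ℝ) ((n : ℝ) - a) + J * (D / p) + J * (D / m)))
      ≤ ((n.choose a : ℕ) : ℝ) * (α₀ ^ j * (1 - α₀) ^ (J - j)) *
          (Real.exp (-(16 * (J : ℝ) ^ 2 / min (a : ℝ) ((n : ℝ) - a))) * (Real.exp (-(j * (D / p))) *
            Real.exp (-((J - j : ℕ) * (D / m))))) := mul_le_mul_of_nonneg_left hexp (by positivity)
    _ = ((n.choose a : ℕ) : ℝ) * ((α₀ ^ j * Real.exp (-(j * (D / p)))) * ((1 - α₀) ^ (J - j) * Real.exp (-((J - j : ℕ) * (D / m))))) *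
          Real.exp (-(16 * (J : ℝ) ^ 2 / min (a : ℝ) ((n : ℝ) - a))) := by ring
    _ ≤ ((n.choose a : ℕ) : ℝ) * (((a : ℝ) / n) ^ j * (1 - (a : ℝ) / n) ^ (J - j)) *
          Real.exp (-(16 * (J : ℝ) ^ 2 / min (a : ℝ) ((n : ℝ) - a))) := by
        refine mul_le_mul_of_nonneg_right (mul_le_mul_of_nonneg_left (mul_le_mul i1 i2 (by positivity) (by positivity)) hC2.le) (by positivity)
    _ ≤ _ := hmain

/-- **The trace/colour constants collapse to Sly's transfer constants**: with
`c = (1-α-β)²/((1-α)(1-β))`, `u = α(1-α)/(1-α-β)²`, `v = β(1-β)/(1-α-β)²`,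
`α^{j⁺}(1-α)^{J-j⁺} β^{j⁻}(1-β)^{J-j⁻} A^{2J} B^{2j⁺} C^{2j⁻} = c^J u^{j⁺} v^{j⁻}` (`j⁺, j⁻ ≤ J`).
[cite: Sly2010, Lemma 3.8 (proof)] -/
theorem trace_colour_eq_transfer {α β : ℝ} (hα : α < 1) (hβ : β < 1) (hαβ : α + β < 1) {J jp jm : ℕ}
    (hjp : jp ≤ J) (hjm : jm ≤ J) :
    α ^ jp * (1 - α) ^ (J - jp) * (β ^ jm * (1 - β) ^ (J - jm)) *
        (slyCA α β ^ (2 * J) * slyCB α β ^ (2 * jp) * slyCC α β ^ (2 * jm)) =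
      ((1 - α - β) ^ 2 / ((1 - α) * (1 - β))) ^ J * (α * (1 - α) / (1 - α - β) ^ 2) ^ jp *
        (β * (1 - β) / (1 - α - β) ^ 2) ^ jm := by
  have h1 : (1 - α) ≠ 0 := ne_of_gt (sub_pos.2 hα)
  have h2 : (1 - β) ≠ 0 := ne_of_gt (sub_pos.2 hβ)
  have h3 : (1 - α - β) ≠ 0 := ne_of_gt (by linarith)
  unfold slyCA slyCB slyCC
  set g := 1 - α - β with hg
  set a1 := 1 - α with ha1
  set b1 := 1 - β with hb1
  rw [pow_sub₀ _ h1 hjp, pow_sub₀ _ h2 hjm]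
  rw [div_pow, div_pow, div_pow, div_pow, div_pow, div_pow, mul_pow, mul_pow, mul_pow]
  field_simp
  ring

end ColourLowerBound

section PlantedLower

variable {n m' q k : ℕ} {mv : Fin k → ℕ}

/-- `f⁺_c ≤ e_c`. [folklore] -/
theorem slyFplus_le_edges (F : (i : Fin k) → Fin (mv i) → SlyWCycle n q ((i : ℕ) + 1)) (c : Option (Fin q))
    (χ : Finset (Σ i : Fin k, Fin (mv i) × Fin ((i : ℕ) + 1))) : slyFplus F c χ ≤ Fintype.card (SlyFamEdgesOf F c) := by
  classical
  unfold slyFplus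
  exact (Finset.card_filter_le _ _).trans (by rw [Finset.card_univ])

/-- `f⁻_c ≤ e_c`. [folklore] -/
theorem slyFminus_le_edges (F : (i : Fin k) → Fin (mv i) → SlyWCycle n q ((i : ℕ) + 1)) (c : Option (Fin q))
    (χ : Finset (Σ i : Fin k, Fin (mv i) × Fin ((i : ℕ) + 1))) : slyFminus F c χ ≤ Fintype.card (SlyFamEdgesOf F c) := by
  classical
  unfold slyFminus
  exact (Finset.card_filter_le _ _).trans (by rw [Finset.card_univ])

/-- Sum of squares versus square of the sum, for naturals. [folklore] -/
theorem sum_natCast_sq_le {ι : Type*} (s : Finset ι) (f : ι → ℕ) :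
    ∑ i ∈ s, ((f i : ℕ) : ℝ) ^ 2 ≤ (∑ i ∈ s, ((f i : ℕ) : ℝ)) ^ 2 := by
  rw [sq (∑ i ∈ s, ((f i : ℕ) : ℝ)), Finset.sum_mul]
  refine Finset.sum_le_sum fun i hi => ?_
  rw [sq]
  exact mul_le_mul_of_nonneg_left (Finset.single_le_sum (fun j _ => Nat.cast_nonneg (f j)) hi) (Nat.cast_nonneg _)

/-- **Product bookkeeping for the per-colour lower bounds**: over a finite colour set,
`Π_c Φ_c · (A^{e_c} B^{f⁺_c} C^{f⁻_c}) · exp(-(κ₁ e_c + κ₂ e_c²)) / N^{e_c}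
 ≥ (Π_c Φ_c) · A^{Σe} B^{Σf⁺} C^{Σf⁻} · exp(-(κ₁ Σe + κ₂ (Σe)²)) / N^{Σe}`. [folklore] -/
theorem prod_colour_factors_ge {ι : Type*} [Fintype ι] (Φ : ι → ℝ) (e fp fm : ι → ℕ) {A B C N κ₁ κ₂ : ℝ}
    (hΦ : ∀ c, 0 ≤ Φ c) (hA : 0 ≤ A) (hB : 0 ≤ B) (hC : 0 ≤ C) (hN : 0 < N) (hκ₂ : 0 ≤ κ₂) :
    (∏ c, Φ c) * (A ^ (∑ c, e c) * B ^ (∑ c, fp c) * C ^ (∑ c, fm c)) *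
        Real.exp (-(κ₁ * (∑ c, (e c : ℝ)) + κ₂ * (∑ c, (e c : ℝ)) ^ 2)) / N ^ (∑ c, e c) ≤
      ∏ c, Φ c * (A ^ e c * B ^ fp c * C ^ fm c) * Real.exp (-(κ₁ * e c + κ₂ * (e c : ℝ) ^ 2)) / N ^ e c := by
  rw [Finset.prod_div_distrib, Finset.prod_mul_distrib, Finset.prod_mul_distrib, Finset.prod_mul_distrib,
    Finset.prod_mul_distrib, Finset.prod_pow_eq_pow_sum, Finset.prod_pow_eq_pow_sum, Finset.prod_pow_eq_pow_sum,
    Finset.prod_pow_eq_pow_sum, ← Real.exp_sum]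
  have hden : 0 < N ^ (∑ c, e c) := pow_pos hN _
  rw [div_le_div_iff_of_pos_right hden]
  refine mul_le_mul_of_nonneg_left (Real.exp_le_exp.2 ?_) ?_
  · rw [Finset.sum_neg_distrib, neg_le_neg_iff, Finset.sum_add_distrib, ← Finset.mul_sum, ← Finset.mul_sum]
    have := sum_natCast_sq_le (Finset.univ : Finset ι) e
    nlinarith
  · exact mul_nonneg (Finset.prod_nonneg fun c _ => hΦ c) (by positivity)
set_option maxHeartbeats 400000 in -- buildfix (bf3-g26): 160k/180k FAIL, 200k PASS at accept time; line-neutral budget line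
open scoped Classical in
/-- **Lower bound on the normalised planted count** (Sly's `P1 · P2 ≥ (1-o(1)) P3 · Π(limits) / N^{2J}`,
uniformly in the trace pair): with reference densities `(p⁺, p⁻)` within `D` of all the colour densities,
`Φ⁰ · A₀^{2J} B₀^{2|χ⁺|} C₀^{2|χ⁻|} · exp(-(24 J D/m + 128 J²/M + 8 J²/n)) / N^{2J} ≤ N_{a,b}(χ⁺,χ⁻)/N_tot`.
[cite: Sly2010, Lemma 3.8 (proof: eqs. (e:cycleRatio)–(e:P2expression))] -/
theorem slyPlantedN_div_ge (F : (i : Fin k) → Fin (mv i) → SlyWCycle n q ((i : ℕ) + 1))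
    {a b ep em : ℕ} (hep : ep ≤ m') (hem : em ≤ m')
    (h0a : 0 < a) (h8Ja : 8 * slyFamJ mv ≤ a) (h2Jb : 2 * slyFamJ mv ≤ b) (hgap : a + b + m' + 8 * slyFamJ mv < n)
    (χp χm : Finset (Σ i : Fin k, Fin (mv i) × Fin ((i : ℕ) + 1)))
    {pp pm D m M : ℝ} (hm : 0 < m) (hM : 0 < M) (hpp : 0 ≤ pp) (hpm : 0 ≤ pm) (hm0 : m ≤ 1 - pp - pm)
    (hmσ : m ≤ 1 - ((a + ep : ℕ) : ℝ) / ((n + m' : ℕ) : ℝ) - ((b + em : ℕ) : ℝ) / ((n + m' : ℕ) : ℝ))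
    (hmτ : m ≤ 1 - (a : ℝ) / n - (b : ℝ) / n)
    (hDσa : |((a + ep : ℕ) : ℝ) / ((n + m' : ℕ) : ℝ) - pp| ≤ D) (hDσb : |((b + em : ℕ) : ℝ) / ((n + m' : ℕ) : ℝ) - pm| ≤ D)
    (hDτa : |(a : ℝ) / n - pp| ≤ D) (hDτb : |(b : ℝ) / n - pm| ≤ D)
    (hMa : M ≤ a) (hMg : M ≤ (n : ℝ) - a - b - m') :
    ((((n + m' - (b + em)).choose (a + ep) : ℕ) : ℝ) / (((n + m').choose (a + ep) : ℕ) : ℝ)) ^ q *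
        ((((n - b).choose a : ℕ) : ℝ) / ((n.choose a : ℕ) : ℝ)) *
        (slyCA pp pm ^ (2 * slyFamJ mv) * slyCB pp pm ^ (2 * χp.card) * slyCC pp pm ^ (2 * χm.card)) *
        Real.exp (-(24 * slyFamJ mv * D / m + 128 * (slyFamJ mv : ℝ) ^ 2 / M + 8 * (slyFamJ mv : ℝ) ^ 2 / n)) /
        ((n + m' : ℕ) : ℝ) ^ (2 * slyFamJ mv) ≤
      (slyPlantedN F m' a b ep em χp χm : ℝ) / ((((n + m').factorial : ℝ) ^ q) * (n.factorial : ℝ)) := by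
  rw [slyPlantedN_div F hep (by omega) χp χm]
  set J := slyFamJ mv with hJ
  -- colour data
  set e : Option (Fin q) → ℕ := fun c => Fintype.card (SlyFamEdgesOf F c) with he
  set fp : Option (Fin q) → ℕ := fun c => slyFplus F c χp with hfp
  set fm : Option (Fin q) → ℕ := fun c => slyFminus F c χm with hfm
  have hesum : ∑ c, e c = 2 * J := sum_card_slyFamEdgesOf F
  have hfpsum : ∑ c, fp c = 2 * χp.card := sum_slyFplus F χp
  have hfmsum : ∑ c, fm c = 2 * χm.card := sum_slyFminus F χm
  have hfp_le : ∀ c, fp c ≤ e c := fun c => slyFplus_le_edges F c χp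
  have hfm_le : ∀ c, fm c ≤ e c := fun c => slyFminus_le_edges F c χm
  have he_le : ∀ c, e c ≤ 2 * J := fun c => by
    rw [← hesum]; exact Finset.single_le_sum (fun _ _ => Nat.zero_le _) (Finset.mem_univ c)
  -- real bookkeeping
  have hn0 : 0 < n := by omega
  have hnr : (0 : ℝ) < n := by exact_mod_cast hn0
  have hNr : (0 : ℝ) < ((n + m' : ℕ) : ℝ) := by exact_mod_cast (show 0 < n + m' by omega)
  have hnN : (n : ℝ) ≤ ((n + m' : ℕ) : ℝ) := by exact_mod_cast Nat.le_add_right n m'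
  have hD : 0 ≤ D := le_trans (abs_nonneg _) hDτa
  set A := slyCA pp pm with hA
  set B := slyCB pp pm with hB
  set C := slyCC pp pm with hC
  have hpp1 : pp < 1 := by linarith
  have hpm1 : pm < 1 := by linarith
  have hppm : pp + pm < 1 := by linarith
  have hA0 : 0 < A := slyCA_pos hpp1 hpm1 hppm
  have hB0 : 0 < B := slyCB_pos hpp1 hppm
  have hC0 : 0 < C := slyCC_pos hpm1 hppm
  set Φσ : ℝ := (((n + m' - (b + em)).choose (a + ep) : ℕ) : ℝ) / (((n + m').choose (a + ep) : ℕ) : ℝ) with hΦσ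
  set Φτ : ℝ := (((n - b).choose a : ℕ) : ℝ) / ((n.choose a : ℕ) : ℝ) with hΦτ
  have hΦσ0 : 0 ≤ Φσ := by positivity
  have hΦτ0 : 0 ≤ Φτ := by positivity
  set Φ : Option (Fin q) → ℝ := fun c => Option.elim c Φτ (fun _ => Φσ) with hΦ
  set κ₁ : ℝ := 12 * D / m with hκ₁
  set κ₂ : ℝ := 32 / M + 2 / n with hκ₂
  have hκ₁0 : 0 ≤ κ₁ := by positivity
  have hκ₂0 : 0 ≤ κ₂ := by positivity
  -- the per-colour lower bounds `LHS c`
  set LHS : Option (Fin q) → ℝ := fun c =>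
    Φ c * (A ^ e c * B ^ fp c * C ^ fm c) * Real.exp (-(κ₁ * e c + κ₂ * (e c : ℝ) ^ 2)) / ((n + m' : ℕ) : ℝ) ^ e c with hLHS
  have hLHS0 : ∀ c, 0 ≤ LHS c := fun c => by
    simp only [hLHS]
    have : 0 ≤ Φ c := by cases c <;> simp [hΦ, hΦσ0, hΦτ0]
    positivity
  -- σ colours
  have hσ : ∀ c : Fin q, LHS (some c) ≤
      (((n + m' - e (some c) - (b + em - fm (some c))).choose (a + ep - fp (some c)) : ℕ) : ℝ) /
          (((n + m' - e (some c)).choose (a + ep - fp (some c)) : ℕ) : ℝ) /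
        ((n + m').descFactorial (e (some c)) : ℝ) := by
    intro c
    have hec := he_le (some c)
    have hfc := hfm_le (some c)
    have hpc := hfp_le (some c)
    have h1 := planted_ratio_ge (n + m') (e (some c)) (fp (some c)) (fm (some c)) (a + ep) (b + em)
      (hfp_le _) (hfm_le _) (by omega) (by omega) (by omega) (by omega) (by omega)
    have h2 := slyColourLimit_ge_ref (α := ((a + ep : ℕ) : ℝ) / ((n + m' : ℕ) : ℝ)) (β := ((b + em : ℕ) : ℝ) / ((n + m' : ℕ) : ℝ))
      hm (by positivity) (by positivity) hpp hpm hmσ hm0 hDσa hDσb (hfp_le (some c)) (hfm_le (some c))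
    -- compare the error exponents
    have hmin : M ≤ min ((a + ep : ℕ) : ℝ) (((n + m' : ℕ) : ℝ) - ((a + ep : ℕ) : ℝ) - ((b + em : ℕ) : ℝ)) := by
      refine le_min ?_ ?_
      · push_cast; linarith
      · push_cast
        have : (ep : ℝ) ≤ m' := by exact_mod_cast hep
        have : (em : ℝ) ≤ m' := by exact_mod_cast hem
        linarith
    have hmin0 : 0 < min ((a + ep : ℕ) : ℝ) (((n + m' : ℕ) : ℝ) - ((a + ep : ℕ) : ℝ) - ((b + em : ℕ) : ℝ)) := lt_of_lt_of_le hM hmin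
    have hexp : Real.exp (-(κ₁ * e (some c) + κ₂ * (e (some c) : ℝ) ^ 2)) ≤
        Real.exp (-(3 * e (some c) * (4 * D / m))) *
          Real.exp (-(32 * (e (some c) : ℝ) ^ 2 / min ((a + ep : ℕ) : ℝ) (((n + m' : ℕ) : ℝ) - ((a + ep : ℕ) : ℝ) - ((b + em : ℕ) : ℝ)) +
            2 * (e (some c) : ℝ) ^ 2 / ((n + m' : ℕ) : ℝ))) := by
      rw [← Real.exp_add]
      refine Real.exp_le_exp.2 ?_
      have i1 : 32 * (e (some c) : ℝ) ^ 2 / min ((a + ep : ℕ) : ℝ) (((n + m' : ℕ) : ℝ) - ((a + ep : ℕ) : ℝ) - ((b + em : ℕ) : ℝ)) ≤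
          32 * (e (some c) : ℝ) ^ 2 / M := div_le_div_of_nonneg_left (by positivity) hM hmin
      have i2 : 2 * (e (some c) : ℝ) ^ 2 / ((n + m' : ℕ) : ℝ) ≤ 2 * (e (some c) : ℝ) ^ 2 / n :=
        div_le_div_of_nonneg_left (by positivity) hnr hnN
      have i3 : κ₁ * e (some c) + κ₂ * (e (some c) : ℝ) ^ 2 =
          3 * e (some c) * (4 * D / m) + (32 * (e (some c) : ℝ) ^ 2 / M + 2 * (e (some c) : ℝ) ^ 2 / n) := by
        simp only [hκ₁, hκ₂]; ring
      linarith
    have hpowpos : 0 < ((n + m' : ℕ) : ℝ) ^ e (some c) := pow_pos hNr _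
    calc LHS (some c)
        = Φσ * (A ^ e (some c) * B ^ fp (some c) * C ^ fm (some c)) * Real.exp (-(κ₁ * e (some c) + κ₂ * (e (some c) : ℝ) ^ 2)) /
            ((n + m' : ℕ) : ℝ) ^ e (some c) := by simp only [hLHS, hΦ, Option.elim]
      _ ≤ Φσ * (A ^ e (some c) * B ^ fp (some c) * C ^ fm (some c)) * (Real.exp (-(3 * e (some c) * (4 * D / m))) *
          Real.exp (-(32 * (e (some c) : ℝ) ^ 2 / min ((a + ep : ℕ) : ℝ) (((n + m' : ℕ) : ℝ) - ((a + ep : ℕ) : ℝ) - ((b + em : ℕ) : ℝ)) +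
            2 * (e (some c) : ℝ) ^ 2 / ((n + m' : ℕ) : ℝ)))) / ((n + m' : ℕ) : ℝ) ^ e (some c) := by
          refine div_le_div_of_nonneg_right (mul_le_mul_of_nonneg_left hexp (by positivity)) hpowpos.le
      _ = Φσ * (A ^ e (some c) * B ^ fp (some c) * C ^ fm (some c) * Real.exp (-(3 * e (some c) * (4 * D / m)))) *
          Real.exp (-(32 * (e (some c) : ℝ) ^ 2 / min ((a + ep : ℕ) : ℝ) (((n + m' : ℕ) : ℝ) - ((a + ep : ℕ) : ℝ) - ((b + em : ℕ) : ℝ)) +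
            2 * (e (some c) : ℝ) ^ 2 / ((n + m' : ℕ) : ℝ))) / ((n + m' : ℕ) : ℝ) ^ e (some c) := by ring
      _ ≤ Φσ * slyColourLimit (((a + ep : ℕ) : ℝ) / ((n + m' : ℕ) : ℝ)) (((b + em : ℕ) : ℝ) / ((n + m' : ℕ) : ℝ)) (e (some c)) (fp (some c)) (fm (some c)) *
          Real.exp (-(32 * (e (some c) : ℝ) ^ 2 / min ((a + ep : ℕ) : ℝ) (((n + m' : ℕ) : ℝ) - ((a + ep : ℕ) : ℝ) - ((b + em : ℕ) : ℝ)) +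
            2 * (e (some c) : ℝ) ^ 2 / ((n + m' : ℕ) : ℝ))) / ((n + m' : ℕ) : ℝ) ^ e (some c) := by
          refine div_le_div_of_nonneg_right (mul_le_mul_of_nonneg_right (mul_le_mul_of_nonneg_left h2 hΦσ0) (by positivity)) hpowpos.le
      _ ≤ _ := h1
  -- τ colour
  have hτ : LHS none ≤
      (((n - e none - (b - fm none)).choose (a - fp none) : ℕ) : ℝ) / (((n - e none).choose (a - fp none) : ℕ) : ℝ) /
        (n.descFactorial (e none) : ℝ) := by
    have hec := he_le none
    have hfc := hfm_le none
    have hpc := hfp_le none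
    have h1 := planted_ratio_ge n (e none) (fp none) (fm none) a b
      (hfp_le _) (hfm_le _) (by omega) h0a (by omega) (by omega) (by omega)
    have h2 := slyColourLimit_ge_ref (α := (a : ℝ) / n) (β := (b : ℝ) / n)
      hm (by positivity) (by positivity) hpp hpm hmτ hm0 hDτa hDτb (hfp_le none) (hfm_le none)
    have hmin : M ≤ min (a : ℝ) ((n : ℝ) - a - b) := by
      refine le_min hMa ?_
      have : (0 : ℝ) ≤ m' := Nat.cast_nonneg m'
      linarith
    have hmin0 : 0 < min (a : ℝ) ((n : ℝ) - a - b) := lt_of_lt_of_le hM hmin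
    have hexp : Real.exp (-(κ₁ * e none + κ₂ * (e none : ℝ) ^ 2)) ≤
        Real.exp (-(3 * e none * (4 * D / m))) *
          Real.exp (-(32 * (e none : ℝ) ^ 2 / min (a : ℝ) ((n : ℝ) - a - b) + 2 * (e none : ℝ) ^ 2 / n)) := by
      rw [← Real.exp_add]
      refine Real.exp_le_exp.2 ?_
      have i1 : 32 * (e none : ℝ) ^ 2 / min (a : ℝ) ((n : ℝ) - a - b) ≤ 32 * (e none : ℝ) ^ 2 / M :=
        div_le_div_of_nonneg_left (by positivity) hM hmin
      have i3 : κ₁ * e none + κ₂ * (e none : ℝ) ^ 2 =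
          3 * e none * (4 * D / m) + (32 * (e none : ℝ) ^ 2 / M + 2 * (e none : ℝ) ^ 2 / n) := by
        simp only [hκ₁, hκ₂]; ring
      linarith
    have hpowN : 0 < ((n + m' : ℕ) : ℝ) ^ e none := pow_pos hNr _
    have hpown : 0 < (n : ℝ) ^ e none := pow_pos hnr _
    have hpow_le : (n : ℝ) ^ e none ≤ ((n + m' : ℕ) : ℝ) ^ e none := pow_le_pow_left₀ hnr.le hnN _
    calc LHS none
        = Φτ * (A ^ e none * B ^ fp none * C ^ fm none) * Real.exp (-(κ₁ * e none + κ₂ * (e none : ℝ) ^ 2)) /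
            ((n + m' : ℕ) : ℝ) ^ e none := by simp only [hLHS, hΦ, Option.elim]
      _ ≤ Φτ * (A ^ e none * B ^ fp none * C ^ fm none) * Real.exp (-(κ₁ * e none + κ₂ * (e none : ℝ) ^ 2)) /
            (n : ℝ) ^ e none := div_le_div_of_nonneg_left (by positivity) hpown hpow_le
      _ ≤ Φτ * (A ^ e none * B ^ fp none * C ^ fm none) * (Real.exp (-(3 * e none * (4 * D / m))) *
          Real.exp (-(32 * (e none : ℝ) ^ 2 / min (a : ℝ) ((n : ℝ) - a - b) + 2 * (e none : ℝ) ^ 2 / n))) / (n : ℝ) ^ e none := by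
          refine div_le_div_of_nonneg_right (mul_le_mul_of_nonneg_left hexp (by positivity)) hpown.le
      _ = Φτ * (A ^ e none * B ^ fp none * C ^ fm none * Real.exp (-(3 * e none * (4 * D / m)))) *
          Real.exp (-(32 * (e none : ℝ) ^ 2 / min (a : ℝ) ((n : ℝ) - a - b) + 2 * (e none : ℝ) ^ 2 / n)) / (n : ℝ) ^ e none := by ring
      _ ≤ Φτ * slyColourLimit ((a : ℝ) / n) ((b : ℝ) / n) (e none) (fp none) (fm none) *
          Real.exp (-(32 * (e none : ℝ) ^ 2 / min (a : ℝ) ((n : ℝ) - a - b) + 2 * (e none : ℝ) ^ 2 / n)) / (n : ℝ) ^ e none := by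
          refine div_le_div_of_nonneg_right (mul_le_mul_of_nonneg_right (mul_le_mul_of_nonneg_left h2 hΦτ0) (by positivity)) hpown.le
      _ ≤ _ := h1
  -- assemble the product
  have hprod : ∏ c : Option (Fin q), LHS c ≤
      (∏ c : Fin q, (((n + m' - e (some c) - (b + em - fm (some c))).choose (a + ep - fp (some c)) : ℕ) : ℝ) /
          (((n + m' - e (some c)).choose (a + ep - fp (some c)) : ℕ) : ℝ) / ((n + m').descFactorial (e (some c)) : ℝ)) *
        ((((n - e none - (b - fm none)).choose (a - fp none) : ℕ) : ℝ) / (((n - e none).choose (a - fp none) : ℕ) : ℝ) /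
          (n.descFactorial (e none) : ℝ)) := by
    rw [Fintype.prod_option, mul_comm]
    refine mul_le_mul (Finset.prod_le_prod (fun c _ => hLHS0 (some c)) fun c _ => hσ c) hτ (hLHS0 none)
      (Finset.prod_nonneg fun c _ => by positivity)
  refine le_trans ?_ hprod
  -- the aggregated form of `∏ LHS`
  have hagg := prod_colour_factors_ge (κ₁ := κ₁) (κ₂ := κ₂) Φ e fp fm (fun c => by cases c <;> simp [hΦ, hΦσ0, hΦτ0]) hA0.le hB0.le hC0.le hNr hκ₂0
  have hLHSprod : ∏ c : Option (Fin q), LHS c =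
      ∏ c, Φ c * (A ^ e c * B ^ fp c * C ^ fm c) * Real.exp (-(κ₁ * e c + κ₂ * (e c : ℝ) ^ 2)) / ((n + m' : ℕ) : ℝ) ^ e c := by
    simp only [hLHS]
  rw [hLHSprod]
  refine le_trans ?_ hagg
  · -- compare our target with the aggregated lower bound
    rw [hesum, hfpsum, hfmsum]
    have hΦprod : ∏ c, Φ c = Φσ ^ q * Φτ := by
      rw [Fintype.prod_option]
      simp only [hΦ, Option.elim, Finset.prod_const, Finset.card_univ, Fintype.card_fin]
      ring
    rw [hΦprod]
    have hesumR : ∑ c, (e c : ℝ) = 2 * J := by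
      have := congrArg (Nat.cast : ℕ → ℝ) hesum
      push_cast at this
      exact this
    rw [hesumR]
    have hden : 0 < ((n + m' : ℕ) : ℝ) ^ (2 * J) := pow_pos hNr _
    rw [div_le_div_iff_of_pos_right hden]
    refine mul_le_mul_of_nonneg_left (Real.exp_le_exp.2 ?_) (by positivity)
    simp only [hκ₁, hκ₂]
    have hJ0 : (0 : ℝ) ≤ J := Nat.cast_nonneg J
    have : 12 * D / m * (2 * (J : ℝ)) + (32 / M + 2 / n) * (2 * (J : ℝ)) ^ 2 =
        24 * J * D / m + 128 * (J : ℝ) ^ 2 / M + 8 * (J : ℝ) ^ 2 / n := by ring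
    linarith

end PlantedLower

section PerTrace

variable {n m' q k : ℕ} {mv : Fin k → ℕ}

/-- **Both trace-count factors against their reference limits**:
`C(n,a) C(n,b) · p⁺^{j⁺}(1-p⁺)^{J-j⁺} p⁻^{j⁻}(1-p⁻)^{J-j⁻} · exp(-(32J²/M + 2J D/p + 2J D/m)) ≤ C(n-J,a-j⁺) C(n-J,b-j⁻)`.
[cite: Sly2010, Lemma 3.8 (proof: configurations `Υ` compatible with `ξ`)] -/
theorem traceCounts_ge_ref {n a b J jp jm : ℕ} (hjp : jp ≤ J) (hjm : jm ≤ J) (h0a : 0 < a) (h0b : 0 < b)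
    (h4Ja : 4 * J ≤ a) (h4Jb : 4 * J ≤ b) (hna : 4 * J ≤ n - a) (hnb : 4 * J ≤ n - b) (han : a < n) (hbn : b < n)
    {pp pm D p m M : ℝ} (hp : 0 < p) (hm : 0 < m) (hM : 0 < M) (hpa : p ≤ (a : ℝ) / n) (hpb : p ≤ (b : ℝ) / n)
    (hppp : p ≤ pp) (hppm : p ≤ pm) (hma : m ≤ 1 - (a : ℝ) / n) (hmb : m ≤ 1 - (b : ℝ) / n) (hmpp : m ≤ 1 - pp) (hmpm : m ≤ 1 - pm)
    (hDa : |(a : ℝ) / n - pp| ≤ D) (hDb : |(b : ℝ) / n - pm| ≤ D)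
    (hMa : M ≤ min (a : ℝ) ((n : ℝ) - a)) (hMb : M ≤ min (b : ℝ) ((n : ℝ) - b)) :
    ((n.choose a : ℕ) : ℝ) * ((n.choose b : ℕ) : ℝ) * (pp ^ jp * (1 - pp) ^ (J - jp) * (pm ^ jm * (1 - pm) ^ (J - jm))) *
        Real.exp (-(32 * (J : ℝ) ^ 2 / M + 2 * J * (D / p) + 2 * J * (D / m))) ≤
      (((n - J).choose (a - jp) : ℕ) : ℝ) * (((n - J).choose (b - jm) : ℕ) : ℝ) := by
  have ha := traceCount_ge_ref n a J jp hjp h0a h4Ja hna han hp hm hpa hppp hma hmpp hDa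
  have hb := traceCount_ge_ref n b J jm hjm h0b h4Jb hnb hbn hp hm hpb hppm hmb hmpm hDb
  have hD : 0 ≤ D := le_trans (abs_nonneg _) hDa
  have hpp0 : 0 < pp := lt_of_lt_of_le hp hppp
  have hpm0 : 0 < pm := lt_of_lt_of_le hp hppm
  have hpp1 : 0 < 1 - pp := lt_of_lt_of_le hm hmpp
  have hpm1 : 0 < 1 - pm := lt_of_lt_of_le hm hmpm
  have hmina : 0 < min (a : ℝ) ((n : ℝ) - a) := lt_of_lt_of_le hM hMa
  have hminb : 0 < min (b : ℝ) ((n : ℝ) - b) := lt_of_lt_of_le hM hMb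
  have hexp : Real.exp (-(32 * (J : ℝ) ^ 2 / M + 2 * J * (D / p) + 2 * J * (D / m))) ≤
      Real.exp (-(16 * (J : ℝ) ^ 2 / min (a : ℝ) ((n : ℝ) - a) + J * (D / p) + J * (D / m))) *
        Real.exp (-(16 * (J : ℝ) ^ 2 / min (b : ℝ) ((n : ℝ) - b) + J * (D / p) + J * (D / m))) := by
    rw [← Real.exp_add]
    refine Real.exp_le_exp.2 ?_
    have i1 : 16 * (J : ℝ) ^ 2 / min (a : ℝ) ((n : ℝ) - a) ≤ 16 * (J : ℝ) ^ 2 / M :=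
      div_le_div_of_nonneg_left (by positivity) hM hMa
    have i2 : 16 * (J : ℝ) ^ 2 / min (b : ℝ) ((n : ℝ) - b) ≤ 16 * (J : ℝ) ^ 2 / M :=
      div_le_div_of_nonneg_left (by positivity) hM hMb
    have : 32 * (J : ℝ) ^ 2 / M = 16 * (J : ℝ) ^ 2 / M + 16 * (J : ℝ) ^ 2 / M := by ring
    linarith
  calc ((n.choose a : ℕ) : ℝ) * ((n.choose b : ℕ) : ℝ) * (pp ^ jp * (1 - pp) ^ (J - jp) * (pm ^ jm * (1 - pm) ^ (J - jm))) *
        Real.exp (-(32 * (J : ℝ) ^ 2 / M + 2 * J * (D / p) + 2 * J * (D / m)))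
      ≤ ((n.choose a : ℕ) : ℝ) * ((n.choose b : ℕ) : ℝ) * (pp ^ jp * (1 - pp) ^ (J - jp) * (pm ^ jm * (1 - pm) ^ (J - jm))) *
          (Real.exp (-(16 * (J : ℝ) ^ 2 / min (a : ℝ) ((n : ℝ) - a) + J * (D / p) + J * (D / m))) *
            Real.exp (-(16 * (J : ℝ) ^ 2 / min (b : ℝ) ((n : ℝ) - b) + J * (D / p) + J * (D / m)))) :=
        mul_le_mul_of_nonneg_left hexp (by positivity)
    _ = (((n.choose a : ℕ) : ℝ) * (pp ^ jp * (1 - pp) ^ (J - jp)) *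
          Real.exp (-(16 * (J : ℝ) ^ 2 / min (a : ℝ) ((n : ℝ) - a) + J * (D / p) + J * (D / m)))) *
        (((n.choose b : ℕ) : ℝ) * (pm ^ jm * (1 - pm) ^ (J - jm)) *
          Real.exp (-(16 * (J : ℝ) ^ 2 / min (b : ℝ) ((n : ℝ) - b) + J * (D / p) + J * (D / m)))) := by ring
    _ ≤ _ := mul_le_mul ha hb (by positivity) (Nat.cast_nonneg _)

/-- The first-moment colour factor `Φ⁰ = (C(N-b',a')/C(N,a'))^q · C(n-b,a)/C(n,a)`. [cite: Sly2010, proof of Lemma 3.1] -/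
noncomputable def slyPhi0 (n m' q a b ep em : ℕ) : ℝ :=
  ((((n + m' - (b + em)).choose (a + ep) : ℕ) : ℝ) / (((n + m').choose (a + ep) : ℕ) : ℝ)) ^ q *
    ((((n - b).choose a : ℕ) : ℝ) / ((n.choose a : ℕ) : ℝ))

/-- The accumulated relative error of the planted lower bound: `26JD/m + 2JD/p + 160J²/M + 8J²/n`. [folklore] -/
noncomputable def slyErrB (J : ℕ) (D p m M : ℝ) (n : ℕ) : ℝ :=
  26 * J * D / m + 2 * J * (D / p) + 160 * (J : ℝ) ^ 2 / M + 8 * (J : ℝ) ^ 2 / n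

/-- `slyErrB ≥ 0`. [folklore] -/
theorem slyErrB_nonneg (J : ℕ) {D p m M : ℝ} (hD : 0 ≤ D) (hp : 0 < p) (hm : 0 < m) (hM : 0 < M) (n : ℕ) :
    0 ≤ slyErrB J D p m M n := by
  unfold slyErrB; positivity

/-- `slyErrB` is monotone in `J`. [folklore] -/
theorem slyErrB_mono {J J' : ℕ} (h : J ≤ J') {D p m M : ℝ} (hD : 0 ≤ D) (hp : 0 < p) (hm : 0 < m) (hM : 0 < M) (n : ℕ) :
    slyErrB J D p m M n ≤ slyErrB J' D p m M n := by
  unfold slyErrB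
  have h' : (J : ℝ) ≤ J' := by exact_mod_cast h
  have hJ : (0 : ℝ) ≤ J := Nat.cast_nonneg J
  have h2 : (J : ℝ) ^ 2 ≤ (J' : ℝ) ^ 2 := by nlinarith
  have hn : (0 : ℝ) ≤ (n : ℝ)⁻¹ := inv_nonneg.2 (Nat.cast_nonneg n)
  have t1 : 26 * J * D / m ≤ 26 * J' * D / m := by
    rw [div_le_div_iff_of_pos_right hm]; nlinarith
  have t2 : 2 * J * (D / p) ≤ 2 * J' * (D / p) := by
    have := div_nonneg hD hp.le; nlinarith
  have t3 : 160 * (J : ℝ) ^ 2 / M ≤ 160 * (J' : ℝ) ^ 2 / M := by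
    rw [div_le_div_iff_of_pos_right hM]; nlinarith
  have t4 : 8 * (J : ℝ) ^ 2 / n ≤ 8 * (J' : ℝ) ^ 2 / n := by
    rw [div_eq_mul_inv, div_eq_mul_inv]; nlinarith
  linarith

open scoped Classical in
/-- **The per-trace planted term dominates the transfer weight** (the core of Sly's Lemma 3.8, lower
half, for vertex-disjoint families): for every trace pair `(χ⁺, χ⁻)`,
`C(n,a)C(n,b) N_tot Φ⁰ e^{-Err} N^{-2J} · c^J u^{|χ⁺|} v^{|χ⁻|} ≤ C(n-J,a-|χ⁺|) C(n-J,b-|χ⁻|) N_{a,b}(χ⁺,χ⁻)`.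
[cite: Sly2010, Lemma 3.8 (proof)] -/
theorem planted_trace_term_ge (F : (i : Fin k) → Fin (mv i) → SlyWCycle n q ((i : ℕ) + 1))
    {a b ep em : ℕ} (hep : ep ≤ m') (hem : em ≤ m')
    (h0a : 0 < a) (h0b : 0 < b) (h8Ja : 8 * slyFamJ mv ≤ a) (h4Jb : 4 * slyFamJ mv ≤ b) (hgap : a + b + m' + 8 * slyFamJ mv < n)
    (χp χm : Finset (Σ i : Fin k, Fin (mv i) × Fin ((i : ℕ) + 1)))
    {pp pm D p m M : ℝ} (hp : 0 < p) (hm : 0 < m) (hM : 0 < M) (hppp : p ≤ pp) (hppm : p ≤ pm) (hm0 : m ≤ 1 - pp - pm)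
    (hpa : p ≤ (a : ℝ) / n) (hpb : p ≤ (b : ℝ) / n)
    (hmσ : m ≤ 1 - ((a + ep : ℕ) : ℝ) / ((n + m' : ℕ) : ℝ) - ((b + em : ℕ) : ℝ) / ((n + m' : ℕ) : ℝ))
    (hmτ : m ≤ 1 - (a : ℝ) / n - (b : ℝ) / n)
    (hDσa : |((a + ep : ℕ) : ℝ) / ((n + m' : ℕ) : ℝ) - pp| ≤ D) (hDσb : |((b + em : ℕ) : ℝ) / ((n + m' : ℕ) : ℝ) - pm| ≤ D)
    (hDτa : |(a : ℝ) / n - pp| ≤ D) (hDτb : |(b : ℝ) / n - pm| ≤ D)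
    (hMa : M ≤ a) (hMb : M ≤ b) (hMg : M ≤ (n : ℝ) - a - b - m') :
    ((n.choose a : ℕ) : ℝ) * ((n.choose b : ℕ) : ℝ) * ((((n + m').factorial : ℝ) ^ q) * (n.factorial : ℝ)) *
        slyPhi0 n m' q a b ep em * Real.exp (-slyErrB (slyFamJ mv) D p m M n) / ((n + m' : ℕ) : ℝ) ^ (2 * slyFamJ mv) *
        (((1 - pp - pm) ^ 2 / ((1 - pp) * (1 - pm))) ^ slyFamJ mv * (pp * (1 - pp) / (1 - pp - pm) ^ 2) ^ χp.card *
          (pm * (1 - pm) / (1 - pp - pm) ^ 2) ^ χm.card) ≤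
      ((((n - slyFamJ mv).choose (a - χp.card) : ℕ) : ℝ) * (((n - slyFamJ mv).choose (b - χm.card) : ℕ) : ℝ)) *
        (slyPlantedN F m' a b ep em χp χm : ℝ) := by
  set J := slyFamJ mv with hJ
  have hjp : χp.card ≤ J := by
    have := Finset.card_le_univ χp; rwa [card_slyFamSlots] at this
  have hjm : χm.card ≤ J := by
    have := Finset.card_le_univ χm; rwa [card_slyFamSlots] at this
  have hpp0 : 0 ≤ pp := le_trans hp.le hppp
  have hpm0 : 0 ≤ pm := le_trans hp.le hppm
  have hpp1 : pp < 1 := by linarith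
  have hpm1 : pm < 1 := by linarith
  have hppm1 : pp + pm < 1 := by linarith
  have hD : 0 ≤ D := le_trans (abs_nonneg _) hDτa
  have hNtot : (0 : ℝ) < (((n + m').factorial : ℝ) ^ q) * (n.factorial : ℝ) := by
    have h1 : (0 : ℝ) < (n + m').factorial := by exact_mod_cast Nat.factorial_pos _
    have h2 : (0 : ℝ) < n.factorial := by exact_mod_cast Nat.factorial_pos _
    positivity
  -- the two ingredients
  have h1 := slyPlantedN_div_ge F hep hem h0a h8Ja (by omega) hgap χp χm hm hM hpp0 hpm0 hm0 hmσ hmτ hDσa hDσb hDτa hDτb hMa hMg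
  rw [le_div_iff₀ hNtot] at h1
  have hm0' : (0 : ℝ) ≤ m' := Nat.cast_nonneg m'
  have h2 := traceCounts_ge_ref (n := n) (a := a) (b := b) (J := J) hjp hjm h0a h0b (by omega) h4Jb (by omega) (by omega) (by omega) (by omega)
    hp hm hM hpa hpb hppp hppm (by linarith [div_nonneg (Nat.cast_nonneg b) (Nat.cast_nonneg n : (0:ℝ) ≤ n)])
    (by linarith [div_nonneg (Nat.cast_nonneg a) (Nat.cast_nonneg n : (0:ℝ) ≤ n)]) (by linarith) (by linarith) hDτa hDτb
    (le_min hMa (by linarith [(Nat.cast_nonneg b : (0:ℝ) ≤ b)])) (le_min hMb (by linarith [(Nat.cast_nonneg a : (0:ℝ) ≤ a)]))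
  -- the algebraic identity
  have hid := trace_colour_eq_transfer hpp1 hpm1 hppm1 hjp hjm
  -- multiply
  have hL0 : 0 ≤ ((n.choose a : ℕ) : ℝ) * ((n.choose b : ℕ) : ℝ) * (pp ^ χp.card * (1 - pp) ^ (J - χp.card) * (pm ^ χm.card * (1 - pm) ^ (J - χm.card))) *
      Real.exp (-(32 * (J : ℝ) ^ 2 / M + 2 * J * (D / p) + 2 * J * (D / m))) := by
    have := sub_nonneg.2 hpp1.le; have := sub_nonneg.2 hpm1.le; positivity
  have hR0 : 0 ≤ slyPhi0 n m' q a b ep em *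
      (slyCA pp pm ^ (2 * J) * slyCB pp pm ^ (2 * χp.card) * slyCC pp pm ^ (2 * χm.card)) *
      Real.exp (-(24 * J * D / m + 128 * (J : ℝ) ^ 2 / M + 8 * (J : ℝ) ^ 2 / n)) / ((n + m' : ℕ) : ℝ) ^ (2 * J) *
      ((((n + m').factorial : ℝ) ^ q) * (n.factorial : ℝ)) := by
    have := slyCA_pos hpp1 hpm1 hppm1; have := slyCB_pos hpp1 hppm1; have := slyCC_pos hpm1 hppm1
    unfold slyPhi0; positivity
  have hprod := mul_le_mul h2 h1 hR0 (by positivity)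
  refine le_trans (le_of_eq ?_) (le_trans hprod (le_of_eq (by ring)))
  -- identify the left-hand sides
  rw [← hid]
  unfold slyErrB slyPhi0
  have hexp : Real.exp (-(26 * J * D / m + 2 * J * (D / p) + 160 * (J : ℝ) ^ 2 / M + 8 * (J : ℝ) ^ 2 / n)) =
      Real.exp (-(32 * (J : ℝ) ^ 2 / M + 2 * J * (D / p) + 2 * J * (D / m))) *
        Real.exp (-(24 * J * D / m + 128 * (J : ℝ) ^ 2 / M + 8 * (J : ℝ) ^ 2 / n)) := by
    rw [← Real.exp_add]; congr 1; ring
  rw [hexp]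
  unfold slyPhi0 at hR0
  ring

end PerTrace

section Exchange

variable {n m' q k : ℕ} {mv : Fin k → ℕ}

open scoped Classical in
/-- **Exchange inequality** (double counting, keeping only the vertex-disjoint families):
`Σ_{F disjoint} Σ_{|S|=a,|T|=b} #{ω ⊇ F, (S,T) independent} ≤ Σ_ω Z_{a,b}(ω) · Π_i DT_i(ω)`, with the
inner sums in trace form. [cite: Sly2010, Lemma 3.8 (proof: `E[Y_n [X]_m] = Σ P(cycles ⊆ G̃) E[Y_n | cycles]`)] -/
theorem sum_famDisjoint_planted_le (mv : Fin k → ℕ) (a b : ℕ) (Ep Em : Finset (Fin m')) :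
    (∑ F : (i : Fin k) → Fin (mv i) → SlyWCycle n q ((i : ℕ) + 1), if SlyFamDisjoint F then
        ∑ χp : Finset (Σ i : Fin k, Fin (mv i) × Fin ((i : ℕ) + 1)), ∑ χm : Finset (Σ i : Fin k, Fin (mv i) × Fin ((i : ℕ) + 1)),
          (if χp.card ≤ a then (n - slyFamJ mv).choose (a - χp.card) else 0) *
            ((if χm.card ≤ b then (n - slyFamJ mv).choose (b - χm.card) else 0) *
              (if SlyFamFeasTr χp χm then slyPlantedN F m' a b Ep.card Em.card χp χm else 0)) else 0) ≤
      ∑ ω : (Fin q → Equiv.Perm (Fin (n + m'))) × Equiv.Perm (Fin n),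
        slyZab n m' q a b Ep Em ω * ∏ i : Fin k, slyDistinctTuples n m' q ((i : ℕ) + 1) (mv i) ω.1 ω.2 := by
  -- the right side as a sum over families
  have hR : ∀ ω : (Fin q → Equiv.Perm (Fin (n + m'))) × Equiv.Perm (Fin n),
      slyZab n m' q a b Ep Em ω * ∏ i : Fin k, slyDistinctTuples n m' q ((i : ℕ) + 1) (mv i) ω.1 ω.2 =
        ∑ F : (i : Fin k) → Fin (mv i) → SlyWCycle n q ((i : ℕ) + 1),
          if (∀ i a, (F i a).Present ω.1 ω.2) ∧ SlyFamDistinct F then slyZab n m' q a b Ep Em ω else 0 := by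
    intro ω
    rw [prod_slyDistinctTuples_eq_card, Finset.card_filter, Finset.mul_sum]
    refine Finset.sum_congr rfl fun F _ => ?_
    split_ifs <;> simp
  rw [Fintype.sum_congr _ _ hR, Finset.sum_comm]
  refine Finset.sum_le_sum fun F _ => ?_
  by_cases hF : SlyFamDisjoint F
  · rw [if_pos hF, ← sum_planted_slice hF a b Ep Em]
    have hd := famDistinct_of_famDisjoint hF
    simp only [hd, and_true]
    apply le_of_eq
    -- both sides count the triples `(S, T, ω)` with `F ⊆ ω` and `(S,T)` independent
    set PA := (univ : Finset (Fin n)).powersetCard a with hPA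
    set PB := (univ : Finset (Fin n)).powersetCard b with hPB
    have hZ : ∀ ω : (Fin q → Equiv.Perm (Fin (n + m'))) × Equiv.Perm (Fin n),
        (if (∀ i a, (F i a).Present ω.1 ω.2) then slyZab n m' q a b Ep Em ω else 0) =
          ∑ ST ∈ PA ×ˢ PB, if (∀ i a, (F i a).Present ω.1 ω.2) ∧ SlyCoreIndep ω.1 ω.2 ST.1 ST.2 Ep Em then 1 else 0 := by
      intro ω
      unfold slyZab
      rw [Finset.card_filter]
      by_cases hP : ∀ i a, (F i a).Present ω.1 ω.2
      · simp only [hP, implies_true, if_true, true_and, hPA, hPB]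
      · simp only [hP, if_false, false_and, Finset.sum_const_zero]
    rw [Fintype.sum_congr _ _ hZ,
      Finset.sum_comm (s := (Finset.univ : Finset ((Fin q → Equiv.Perm (Fin (n + m'))) × Equiv.Perm (Fin n)))) (t := PA ×ˢ PB),
      Finset.sum_product]
    refine Finset.sum_congr rfl fun S _ => Finset.sum_congr rfl fun T _ => ?_
    rw [Fintype.card_subtype, Finset.card_filter]
  · rw [if_neg hF]; exact Nat.zero_le _

open scoped Classical in
/-- **The number of vertex-disjoint families**: `#patterns · (n^{(J)})²`. [folklore] -/
theorem sum_famDisjoint_indicator (mv : Fin k → ℕ) :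
    (∑ F : (i : Fin k) → Fin (mv i) → SlyWCycle n q ((i : ℕ) + 1), if SlyFamDisjoint F then (1 : ℝ) else 0) =
      (∏ i : Fin k, ((q : ℝ) ^ (2 * ((i : ℕ) + 1)) + q) ^ (mv i)) * ((n.descFactorial (slyFamJ mv) : ℕ) : ℝ) ^ 2 := by
  have h := sum_famDisjoint_pattern (n := n) (q := q) (mv := mv) (M := ℝ) (fun _ => (1 : ℝ))
  rw [h, Finset.sum_const, Finset.card_univ, smul_smul, nsmul_eq_mul, mul_one, ← card_fam_patterns mv]
  push_cast
  ring

open scoped Classical in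
/-- **The trace sum evaluates to `Π_i (1 + r^{i+1})^{m_i}`** at Sly's constants, `r = p⁺p⁻/((1-p⁺)(1-p⁻))`.
[cite: Sly2010, Lemma 3.8 (`(1+δ_i)^{m_i}`)] -/
theorem sum_feasTr_transfer {pp pm : ℝ} (hpp : pp < 1) (hpm : pm < 1) (h : pp + pm < 1) (mv : Fin k → ℕ) :
    ∑ χp : Finset (Σ i : Fin k, Fin (mv i) × Fin ((i : ℕ) + 1)), ∑ χm : Finset (Σ i : Fin k, Fin (mv i) × Fin ((i : ℕ) + 1)),
        (if SlyFamFeasTr χp χm then (1 : ℝ) else 0) *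
          (((1 - pp - pm) ^ 2 / ((1 - pp) * (1 - pm))) ^ slyFamJ mv *
            ((pp * (1 - pp) / (1 - pp - pm) ^ 2) ^ χp.card * (pm * (1 - pm) / (1 - pp - pm) ^ 2) ^ χm.card)) =
      ∏ i : Fin k, (1 + (pp * pm / ((1 - pp) * (1 - pm))) ^ ((i : ℕ) + 1)) ^ (mv i) := by
  rw [sum_traceWeight_eq_prod_cycleSum]
  obtain ⟨h1, h2⟩ := sly_transfer_constants hpp hpm h
  refine Finset.prod_congr rfl fun i _ => ?_
  rw [slyCycleSum_identity _ _ h1 h2]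

end Exchange

section Main

variable {n m' q k : ℕ}

open scoped Classical in
/-- **The planted factorial moments of the cycle counts, lower bound** (Sly's Lemma 3.8 / MWW09
Lemma 7.4, lower half, in counting form): for slices `(a, b)` near the reference densities,
`(Σ_ω Z_{a,b}) · Π_i ((q^{2(i+1)}+q)(1+r^{i+1}))^{m_i} · [(n^{(J)})² N^{-2J} e^{-Err}] ≤ Σ_ω Z_{a,b}(ω) Π_i DT_i(ω)`,
`r = p⁺p⁻/((1-p⁺)(1-p⁻))`. [cite: Sly2010, Lemma 3.8; MosselWeitzWormald2008, Lemma 7.4] -/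
theorem sum_slyZab_mul_prod_ge (mv : Fin k → ℕ) {a b : ℕ} (Ep Em : Finset (Fin m'))
    (h0a : 0 < a) (h0b : 0 < b) (h8Ja : 8 * slyFamJ mv ≤ a) (h4Jb : 4 * slyFamJ mv ≤ b) (hgap : a + b + m' + 8 * slyFamJ mv < n)
    {pp pm D p m M : ℝ} (hp : 0 < p) (hm : 0 < m) (hM : 0 < M) (hppp : p ≤ pp) (hppm : p ≤ pm) (hm0 : m ≤ 1 - pp - pm)
    (hpa : p ≤ (a : ℝ) / n) (hpb : p ≤ (b : ℝ) / n)
    (hmσ : m ≤ 1 - ((a + Ep.card : ℕ) : ℝ) / ((n + m' : ℕ) : ℝ) - ((b + Em.card : ℕ) : ℝ) / ((n + m' : ℕ) : ℝ))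
    (hmτ : m ≤ 1 - (a : ℝ) / n - (b : ℝ) / n)
    (hDσa : |((a + Ep.card : ℕ) : ℝ) / ((n + m' : ℕ) : ℝ) - pp| ≤ D) (hDσb : |((b + Em.card : ℕ) : ℝ) / ((n + m' : ℕ) : ℝ) - pm| ≤ D)
    (hDτa : |(a : ℝ) / n - pp| ≤ D) (hDτb : |(b : ℝ) / n - pm| ≤ D)
    (hMa : M ≤ a) (hMb : M ≤ b) (hMg : M ≤ (n : ℝ) - a - b - m') :
    (∑ ω : (Fin q → Equiv.Perm (Fin (n + m'))) × Equiv.Perm (Fin n), ((slyZab n m' q a b Ep Em ω : ℕ) : ℝ)) *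
        (∏ i : Fin k, ((((q : ℝ) ^ (2 * ((i : ℕ) + 1)) + q)) * (1 + (pp * pm / ((1 - pp) * (1 - pm))) ^ ((i : ℕ) + 1))) ^ (mv i)) *
        (((n.descFactorial (slyFamJ mv) : ℕ) : ℝ) ^ 2 / ((n + m' : ℕ) : ℝ) ^ (2 * slyFamJ mv) *
          Real.exp (-slyErrB (slyFamJ mv) D p m M n)) ≤
      ∑ ω : (Fin q → Equiv.Perm (Fin (n + m'))) × Equiv.Perm (Fin n),
        ((slyZab n m' q a b Ep Em ω : ℕ) : ℝ) * ∏ i : Fin k, ((slyDistinctTuples n m' q ((i : ℕ) + 1) (mv i) ω.1 ω.2 : ℕ) : ℝ) := by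
  set J := slyFamJ mv with hJ
  have hep : Ep.card ≤ m' := by simpa using Finset.card_le_univ Ep
  have hem : Em.card ≤ m' := by simpa using Finset.card_le_univ Em
  have hpp0 : 0 ≤ pp := le_trans hp.le hppp
  have hpm0 : 0 ≤ pm := le_trans hp.le hppm
  have hpp1 : pp < 1 := by linarith
  have hpm1 : pm < 1 := by linarith
  have hppm1 : pp + pm < 1 := by linarith
  have hD : 0 ≤ D := le_trans (abs_nonneg _) hDτa
  -- abbreviations
  set Ntot : ℝ := (((n + m').factorial : ℝ) ^ q) * (n.factorial : ℝ) with hNtot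
  set cc : ℝ := (1 - pp - pm) ^ 2 / ((1 - pp) * (1 - pm)) with hcc
  set uu : ℝ := pp * (1 - pp) / (1 - pp - pm) ^ 2 with huu
  set vv : ℝ := pm * (1 - pm) / (1 - pp - pm) ^ 2 with hvv
  set rr : ℝ := pp * pm / ((1 - pp) * (1 - pm)) with hrr
  set BASE : ℝ := ((n.choose a : ℕ) : ℝ) * ((n.choose b : ℕ) : ℝ) * Ntot * slyPhi0 n m' q a b Ep.card Em.card *
    Real.exp (-slyErrB J D p m M n) / ((n + m' : ℕ) : ℝ) ^ (2 * J) with hBASE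
  set T : ℝ := ∏ i : Fin k, (1 + rr ^ ((i : ℕ) + 1)) ^ (mv i) with hT
  set P : ℝ := ∏ i : Fin k, ((q : ℝ) ^ (2 * ((i : ℕ) + 1)) + q) ^ (mv i) with hP
  -- Step 1: exchange
  have hex := sum_famDisjoint_planted_le (n := n) (q := q) mv a b Ep Em
  have hexR : (∑ F : (i : Fin k) → Fin (mv i) → SlyWCycle n q ((i : ℕ) + 1), if SlyFamDisjoint F then
      ∑ χp : Finset (Σ i : Fin k, Fin (mv i) × Fin ((i : ℕ) + 1)), ∑ χm : Finset (Σ i : Fin k, Fin (mv i) × Fin ((i : ℕ) + 1)),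
        (if χp.card ≤ a then (((n - J).choose (a - χp.card) : ℕ) : ℝ) else 0) *
          ((if χm.card ≤ b then (((n - J).choose (b - χm.card) : ℕ) : ℝ) else 0) *
            (if SlyFamFeasTr χp χm then (slyPlantedN F m' a b Ep.card Em.card χp χm : ℝ) else 0)) else 0) ≤
      ∑ ω : (Fin q → Equiv.Perm (Fin (n + m'))) × Equiv.Perm (Fin n),
        ((slyZab n m' q a b Ep Em ω : ℕ) : ℝ) * ∏ i : Fin k, ((slyDistinctTuples n m' q ((i : ℕ) + 1) (mv i) ω.1 ω.2 : ℕ) : ℝ) := by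
    have h' : ((∑ F : (i : Fin k) → Fin (mv i) → SlyWCycle n q ((i : ℕ) + 1), if SlyFamDisjoint F then
        ∑ χp : Finset (Σ i : Fin k, Fin (mv i) × Fin ((i : ℕ) + 1)), ∑ χm : Finset (Σ i : Fin k, Fin (mv i) × Fin ((i : ℕ) + 1)),
          (if χp.card ≤ a then (n - J).choose (a - χp.card) else 0) *
            ((if χm.card ≤ b then (n - J).choose (b - χm.card) else 0) *
              (if SlyFamFeasTr χp χm then slyPlantedN F m' a b Ep.card Em.card χp χm else 0)) else 0 : ℕ) : ℝ) ≤
        ((∑ ω : (Fin q → Equiv.Perm (Fin (n + m'))) × Equiv.Perm (Fin n),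
          slyZab n m' q a b Ep Em ω * ∏ i : Fin k, slyDistinctTuples n m' q ((i : ℕ) + 1) (mv i) ω.1 ω.2 : ℕ) : ℝ) := by
      exact_mod_cast hex
    push_cast at h'
    exact h'
  refine le_trans ?_ hexR
  -- Step 2: per family
  have hfam : ∀ F : (i : Fin k) → Fin (mv i) → SlyWCycle n q ((i : ℕ) + 1),
      (if SlyFamDisjoint F then BASE * T else 0) ≤
        (if SlyFamDisjoint F then
          ∑ χp : Finset (Σ i : Fin k, Fin (mv i) × Fin ((i : ℕ) + 1)), ∑ χm : Finset (Σ i : Fin k, Fin (mv i) × Fin ((i : ℕ) + 1)),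
            (if χp.card ≤ a then (((n - J).choose (a - χp.card) : ℕ) : ℝ) else 0) *
              ((if χm.card ≤ b then (((n - J).choose (b - χm.card) : ℕ) : ℝ) else 0) *
                (if SlyFamFeasTr χp χm then (slyPlantedN F m' a b Ep.card Em.card χp χm : ℝ) else 0)) else 0) := by
    intro F
    by_cases hF : SlyFamDisjoint F
    · rw [if_pos hF, if_pos hF]
      -- the trace sum at the transfer constants
      have htr := sum_feasTr_transfer hpp1 hpm1 hppm1 mv
      rw [← hJ] at htr
      have hBT : BASE * T = ∑ χp : Finset (Σ i : Fin k, Fin (mv i) × Fin ((i : ℕ) + 1)),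
          ∑ χm : Finset (Σ i : Fin k, Fin (mv i) × Fin ((i : ℕ) + 1)),
            (if SlyFamFeasTr χp χm then (1 : ℝ) else 0) * (BASE * (cc ^ J * (uu ^ χp.card * vv ^ χm.card))) := by
        rw [hT, ← htr, Finset.mul_sum]
        refine Finset.sum_congr rfl fun χp _ => ?_
        rw [Finset.mul_sum]
        refine Finset.sum_congr rfl fun χm _ => ?_
        ring
      rw [hBT]
      refine Finset.sum_le_sum fun χp _ => Finset.sum_le_sum fun χm _ => ?_
      have hjp : χp.card ≤ J := by
        have := Finset.card_le_univ χp; rwa [card_slyFamSlots] at this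
      have hjm : χm.card ≤ J := by
        have := Finset.card_le_univ χm; rwa [card_slyFamSlots] at this
      by_cases hfe : SlyFamFeasTr χp χm
      · rw [if_pos hfe, if_pos hfe, if_pos (by omega), if_pos (by omega), one_mul]
        have h := planted_trace_term_ge F hep hem h0a h0b h8Ja h4Jb hgap χp χm hp hm hM hppp hppm hm0 hpa hpb
          hmσ hmτ hDσa hDσb hDτa hDτb hMa hMb hMg
        rw [← hJ] at h
        calc BASE * (cc ^ J * (uu ^ χp.card * vv ^ χm.card))
            = ((n.choose a : ℕ) : ℝ) * ((n.choose b : ℕ) : ℝ) * ((((n + m').factorial : ℝ) ^ q) * (n.factorial : ℝ)) *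
                slyPhi0 n m' q a b Ep.card Em.card * Real.exp (-slyErrB J D p m M n) / ((n + m' : ℕ) : ℝ) ^ (2 * J) *
              (cc ^ J * uu ^ χp.card * vv ^ χm.card) := by simp only [hBASE, hNtot]; ring
          _ ≤ _ := h
          _ = _ := by ring
      · rw [if_neg hfe, if_neg hfe]; simp
    · rw [if_neg hF, if_neg hF]
  refine le_trans ?_ (Finset.sum_le_sum fun F _ => hfam F)
  -- Step 3: count the disjoint families and identify the constants
  have hcount := sum_famDisjoint_indicator (n := n) (q := q) mv
  rw [← hJ, ← hP] at hcount
  have hsumF : (∑ F : (i : Fin k) → Fin (mv i) → SlyWCycle n q ((i : ℕ) + 1), if SlyFamDisjoint F then BASE * T else 0) =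
      BASE * T * (P * ((n.descFactorial J : ℕ) : ℝ) ^ 2) := by
    rw [← hcount, Finset.mul_sum]
    refine Finset.sum_congr rfl fun F _ => ?_
    split_ifs <;> simp
  rw [hsumF]
  -- the first moment
  have hZ := sum_slyZab_eq n m' q a b Ep Em (by omega) (by omega) (by omega) (by omega)
  rw [hZ]
  apply le_of_eq
  have hPT : ∏ i : Fin k, ((((q : ℝ) ^ (2 * ((i : ℕ) + 1)) + q)) * (1 + rr ^ ((i : ℕ) + 1))) ^ (mv i) = P * T := by
    rw [hP, hT, ← Finset.prod_mul_distrib]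
    refine Finset.prod_congr rfl fun i _ => ?_
    rw [mul_pow]
  rw [hPT]
  simp only [hBASE, hNtot, slyPhi0]
  ring

end Main

section Final

variable {n m' q k : ℕ}

open Filter Topology

/-- **The family-count ratio**: `1 - 2J(J+m')/(n+m') ≤ (n^{(J)})² / (n+m')^{2J}` (`J ≤ n`). [folklore] -/
theorem descFactorial_sq_div_ge (n m' J : ℕ) (hJ : J ≤ n) (hN : 0 < n + m') :
    1 - 2 * J * ((J : ℝ) + m') / ((n + m' : ℕ) : ℝ) ≤ ((n.descFactorial J : ℕ) : ℝ) ^ 2 / ((n + m' : ℕ) : ℝ) ^ (2 * J) := by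
  have h1 : (((n + 1 - J : ℕ) : ℝ)) ^ J ≤ ((n.descFactorial J : ℕ) : ℝ) := by
    exact_mod_cast Nat.pow_sub_le_descFactorial n J
  have hNr : (0 : ℝ) < ((n + m' : ℕ) : ℝ) := by exact_mod_cast hN
  have hcast : ((n + 1 - J : ℕ) : ℝ) = (n : ℝ) + 1 - J := by
    rw [Nat.cast_sub (by omega)]; push_cast; ring
  set x : ℝ := (((n + 1 - J : ℕ) : ℝ) - ((n + m' : ℕ) : ℝ)) / ((n + m' : ℕ) : ℝ) with hx
  have h1x : 1 + x = ((n + 1 - J : ℕ) : ℝ) / ((n + m' : ℕ) : ℝ) := by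
    rw [hx]; field_simp; ring
  have hx0 : 0 ≤ ((n + 1 - J : ℕ) : ℝ) := Nat.cast_nonneg _
  have hx2 : -2 ≤ x := by
    rw [hx, le_div_iff₀ hNr]; linarith
  have hb := one_add_mul_le_pow hx2 (2 * J)
  have hxlow : -(((J : ℝ) + m') / ((n + m' : ℕ) : ℝ)) ≤ x := by
    rw [hx, neg_div', div_le_div_iff_of_pos_right hNr, hcast]
    push_cast; linarith
  have hJ0 : (0 : ℝ) ≤ 2 * J := by positivity
  calc 1 - 2 * J * ((J : ℝ) + m') / ((n + m' : ℕ) : ℝ)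
      = 1 + (2 * J : ℝ) * (-(((J : ℝ) + m') / ((n + m' : ℕ) : ℝ))) := by ring
    _ ≤ 1 + (2 * J : ℝ) * x := by nlinarith
    _ = 1 + ((2 * J : ℕ) : ℝ) * x := by push_cast; ring
    _ ≤ (1 + x) ^ (2 * J) := hb
    _ = (((n + 1 - J : ℕ) : ℝ) ^ J) ^ 2 / ((n + m' : ℕ) : ℝ) ^ (2 * J) := by
        rw [h1x, div_pow, ← pow_mul, mul_comm J 2]
    _ ≤ ((n.descFactorial J : ℕ) : ℝ) ^ 2 / ((n + m' : ℕ) : ℝ) ^ (2 * J) :=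
        div_le_div_of_nonneg_right (pow_le_pow_left₀ (by positivity) h1 2) (by positivity)

/-- The density shift of the big colours: `|(a+e)/(n+m') - a/n| ≤ 2m'/n` for `e ≤ m'`, `a ≤ n`. [folklore] -/
theorem abs_density_shift_le {n m' a e : ℕ} (hn : 0 < n) (he : e ≤ m') (ha : a ≤ n) :
    |((a + e : ℕ) : ℝ) / ((n + m' : ℕ) : ℝ) - (a : ℝ) / n| ≤ 2 * (m' : ℝ) / n := by
  have hnr : (0 : ℝ) < n := by exact_mod_cast hn
  have hNr : (0 : ℝ) < ((n + m' : ℕ) : ℝ) := by exact_mod_cast (show 0 < n + m' by omega)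
  have her : (e : ℝ) ≤ m' := by exact_mod_cast he
  have har : (a : ℝ) ≤ n := by exact_mod_cast ha
  have hm0 : (0 : ℝ) ≤ m' := Nat.cast_nonneg m'
  have ha0 : (0 : ℝ) ≤ a := Nat.cast_nonneg a
  have he0 : (0 : ℝ) ≤ e := Nat.cast_nonneg e
  have heq : ((a + e : ℕ) : ℝ) / ((n + m' : ℕ) : ℝ) - (a : ℝ) / n = ((e : ℝ) * n - a * m') / ((n : ℝ) * ((n + m' : ℕ) : ℝ)) := by
    push_cast; field_simp; ring
  rw [heq, abs_div, abs_of_pos (mul_pos hnr hNr), div_le_div_iff₀ (mul_pos hnr hNr) hnr]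
  have hN : ((n + m' : ℕ) : ℝ) = n + m' := by push_cast; ring
  rw [hN]
  have h1 : |(e : ℝ) * n - a * m'| ≤ (m' : ℝ) * n + n * m' := by
    rw [abs_le]; constructor <;> nlinarith
  nlinarith [h1, abs_nonneg ((e : ℝ) * n - a * m')]

set_option maxHeartbeats 1000000 in
open scoped Classical in
/-- **The planted lower bound, `ε`-form** (hypothesis (P) of the small-subgraph-conditioning lemma
for `Y = Z_{a,b}(η)` and the cycle counts): for slices in a `χ`-window around the reference
densities and `n ≥ n₀`,
`(1-ε) (Σ_ω Z_{a,b}) Π_i ((q^{2(i+1)}+q)(1+r^{i+1}))^{m_i} ≤ Σ_ω Z_{a,b}(ω) Π_i DT_i(ω)`,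
uniformly in `m' ≤ n^{1/10}`, the boundary `η`, and `m ≤ B`. [cite: Sly2010, Lemma 3.8; MosselWeitzWormald2008, Lemma 7.4] -/
theorem sly_planted_lower (q k B : ℕ) {pp pm : ℝ} (hpm : 0 < pm) (hle : pm ≤ pp) (hsum : pp + pm < 1) {ε : ℝ} (hε : 0 < ε) :
    ∃ χ : ℝ, 0 < χ ∧ ∃ n₀ : ℕ, ∀ n : ℕ, n₀ ≤ n → ∀ m' : ℕ, (m' : ℝ) ≤ (n : ℝ) ^ (1 / 10 : ℝ) →
      ∀ (Ep Em : Finset (Fin m')) (a b : ℕ), |(a : ℝ) / n - pp| ≤ χ → |(b : ℝ) / n - pm| ≤ χ →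
      ∀ mv : Fin k → ℕ, (∀ i, mv i ≤ B) →
        (1 - ε) * (∑ ω : (Fin q → Equiv.Perm (Fin (n + m'))) × Equiv.Perm (Fin n), ((slyZab n m' q a b Ep Em ω : ℕ) : ℝ)) *
            ∏ i : Fin k, ((((q : ℝ) ^ (2 * ((i : ℕ) + 1)) + q)) * (1 + (pp * pm / ((1 - pp) * (1 - pm))) ^ ((i : ℕ) + 1))) ^ (mv i) ≤
          ∑ ω : (Fin q → Equiv.Perm (Fin (n + m'))) × Equiv.Perm (Fin n),
            ((slyZab n m' q a b Ep Em ω : ℕ) : ℝ) * ∏ i : Fin k, ((slyDistinctTuples n m' q ((i : ℕ) + 1) (mv i) ω.1 ω.2 : ℕ) : ℝ) := by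
  set g : ℝ := 1 - pp - pm with hg
  have hg0 : 0 < g := by rw [hg]; linarith
  set μ : ℝ := min (pm / 2) (g / 4) with hμ
  have hμ0 : 0 < μ := lt_min (by linarith) (by linarith)
  set Jm : ℕ := k * k * B with hJm
  set L : ℝ := 104 * Jm / g + 8 * Jm / pm with hL
  have hL0 : 0 ≤ L := by positivity
  set χ : ℝ := min (min (pm / 2) (g / 8)) (ε / (4 * L + 4)) with hχ
  have hχ0 : 0 < χ := lt_min (lt_min (by linarith) (by linarith)) (by positivity)
  have hχpm : χ ≤ pm / 2 := le_trans (min_le_left _ _) (min_le_left _ _)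
  have hχg : χ ≤ g / 8 := le_trans (min_le_left _ _) (min_le_right _ _)
  have hχε : χ ≤ ε / (4 * L + 4) := min_le_right _ _
  have hLχ : L * χ ≤ ε / 4 := by
    calc L * χ ≤ L * (ε / (4 * L + 4)) := mul_le_mul_of_nonneg_left hχε hL0
      _ ≤ ε / 4 := by
          rw [mul_div_assoc', div_le_div_iff₀ (by positivity) (by norm_num)]
          nlinarith
  refine ⟨χ, hχ0, ?_⟩
  -- the eventual conditions in `n`
  have T0 : Tendsto (fun n : ℕ => ((n : ℝ))⁻¹) atTop (𝓝 0) := tendsto_inv_atTop_zero.comp tendsto_natCast_atTop_atTop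
  have T9 : Tendsto (fun n : ℕ => (n : ℝ) ^ (-(9 / 10) : ℝ)) atTop (𝓝 0) :=
    (tendsto_rpow_neg_atTop (by norm_num)).comp tendsto_natCast_atTop_atTop
  have E0 : ∀ᶠ n : ℕ in atTop, 1 ≤ n := eventually_ge_atTop 1
  have E1 : ∀ᶠ n : ℕ in atTop, (16 * Jm / pm + (8 * Jm + 1) / (g / 4) : ℝ) ≤ n :=
    tendsto_natCast_atTop_atTop.eventually_ge_atTop _
  have E2 : ∀ᶠ n : ℕ in atTop, (n : ℝ) ^ (-(9 / 10) : ℝ) ≤ min (g / 4) (χ / 2) :=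
    T9.eventually_le_const (lt_min (by linarith) (by linarith))
  have E4 : ∀ᶠ n : ℕ in atTop, ((160 / μ + 8) * (Jm : ℝ) ^ 2 + 2 * (Jm : ℝ) ^ 2) * ((n : ℝ))⁻¹ ≤ ε / 8 := by
    have := T0.const_mul ((160 / μ + 8) * (Jm : ℝ) ^ 2 + 2 * (Jm : ℝ) ^ 2)
    rw [mul_zero] at this
    exact this.eventually_le_const (by positivity)
  have E5 : ∀ᶠ n : ℕ in atTop, 2 * (Jm : ℝ) * (n : ℝ) ^ (-(9 / 10) : ℝ) ≤ ε / 8 := by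
    have := T9.const_mul (2 * (Jm : ℝ))
    rw [mul_zero] at this
    exact this.eventually_le_const (by positivity)
  obtain ⟨n₀, hn₀⟩ := Filter.eventually_atTop.1 (E0.and (E1.and (E2.and (E4.and E5))))
  refine ⟨n₀, fun n hn m' hm' Ep Em a b ha hb mv hmv => ?_⟩
  obtain ⟨e0, e1, e2, e4, e5⟩ := hn₀ n hn
  -- basic real facts
  have hn1 : (1 : ℝ) ≤ n := by exact_mod_cast e0
  have hn0 : (0 : ℝ) < n := by linarith
  have hrpow : (n : ℝ) ^ (1 / 10 : ℝ) = (n : ℝ) ^ (-(9 / 10) : ℝ) * n := by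
    rw [show (1 / 10 : ℝ) = -(9 / 10) + 1 by norm_num, Real.rpow_add hn0, Real.rpow_one]
  have e2g : (n : ℝ) ^ (-(9 / 10) : ℝ) ≤ g / 4 := le_trans e2 (min_le_left _ _)
  have e2χ : (n : ℝ) ^ (-(9 / 10) : ℝ) ≤ χ / 2 := le_trans e2 (min_le_right _ _)
  have hm'r : (m' : ℝ) ≤ (n : ℝ) ^ (-(9 / 10) : ℝ) * n := by rwa [hrpow] at hm'
  have hm'g : (m' : ℝ) ≤ g / 4 * n := le_trans hm'r (mul_le_mul_of_nonneg_right e2g hn0.le)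
  have hm'χ : 2 * (m' : ℝ) ≤ χ * n := by
    have := mul_le_mul_of_nonneg_right e2χ hn0.le; linarith only [this, hm'r]
  have hm'0 : (0 : ℝ) ≤ m' := Nat.cast_nonneg m'
  -- the slice sizes
  have ha' := abs_le.1 ha
  have hb' := abs_le.1 hb
  have ha_lo : (pp - χ) * n ≤ a := by
    have : pp - χ ≤ (a : ℝ) / n := by linarith [ha'.1]
    rwa [le_div_iff₀ hn0] at this
  have ha_hi : (a : ℝ) ≤ (pp + χ) * n := by
    have : (a : ℝ) / n ≤ pp + χ := by linarith [ha'.2]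
    rwa [div_le_iff₀ hn0] at this
  have hb_lo : (pm - χ) * n ≤ b := by
    have : pm - χ ≤ (b : ℝ) / n := by linarith [hb'.1]
    rwa [le_div_iff₀ hn0] at this
  have hb_hi : (b : ℝ) ≤ (pm + χ) * n := by
    have : (b : ℝ) / n ≤ pm + χ := by linarith [hb'.2]
    rwa [div_le_iff₀ hn0] at this
  -- `J ≤ Jm` and the size conditions
  have hJ := slyFamJ_le hmv
  rw [← hJm] at hJ
  set J := slyFamJ mv with hJdef
  have hJr : (J : ℝ) ≤ Jm := by exact_mod_cast hJ
  have hJ0 : (0 : ℝ) ≤ J := Nat.cast_nonneg J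
  have e1a : (16 * Jm : ℝ) ≤ pm * n := by
    have h1 : (16 * Jm / pm : ℝ) ≤ n := le_trans (le_add_of_nonneg_right (by positivity)) e1
    rw [div_le_iff₀ hpm] at h1; linarith only [h1]
  have e1b : (8 * Jm + 1 : ℝ) ≤ g / 4 * n := by
    have h1 : ((8 * Jm + 1) / (g / 4) : ℝ) ≤ n := le_trans (le_add_of_nonneg_left (by positivity)) e1
    rw [div_le_iff₀ (by positivity)] at h1; linarith
  have hpma : pm / 2 * n ≤ a := le_trans (mul_le_mul_of_nonneg_right (by linarith only [hle, hχpm]) hn0.le) ha_lo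
  have hpmb : pm / 2 * n ≤ b := le_trans (mul_le_mul_of_nonneg_right (by linarith only [hχpm]) hn0.le) hb_lo
  have hgn : g * n = n - pp * n - pm * n := by rw [hg]; ring
  have hχn : χ * n ≤ g / 8 * n := mul_le_mul_of_nonneg_right hχg hn0.le
  have h0a : 0 < a := by
    have : (0 : ℝ) < a := lt_of_lt_of_le (by positivity) hpma
    exact_mod_cast this
  have h0b : 0 < b := by
    have : (0 : ℝ) < b := lt_of_lt_of_le (by positivity) hpmb
    exact_mod_cast this
  have h8Ja : 8 * J ≤ a := by
    have : (8 * J : ℝ) ≤ a := by linarith only [hJr, e1a, hpma]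
    exact_mod_cast this
  have h4Jb : 4 * J ≤ b := by
    have : (4 * J : ℝ) ≤ b := by linarith only [hJr, e1a, hpmb, hJ0]
    exact_mod_cast this
  have hgap : a + b + m' + 8 * J < n := by
    have : (a : ℝ) + b + m' + 8 * J + 1 ≤ n := by
      linarith only [ha_hi, hb_hi, hm'g, e1b, hJr, hχn, hgn]
    have h' : a + b + m' + 8 * J + 1 ≤ n := by exact_mod_cast this
    omega
  have hep : Ep.card ≤ m' := by simpa using Finset.card_le_univ Ep
  have hem : Em.card ≤ m' := by simpa using Finset.card_le_univ Em
  have han : a ≤ n := by omega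
  have hbn : b ≤ n := by omega
  -- density conditions, with `D = 2χ`, `p = pm/2`, `m = g/2`, `M = μ n`
  have hshA := abs_density_shift_le (a := a) (e := Ep.card) (m' := m') e0 hep han
  have hshB := abs_density_shift_le (a := b) (e := Em.card) (m' := m') e0 hem hbn
  have h2m' : 2 * (m' : ℝ) / n ≤ χ := by rw [div_le_iff₀ hn0]; exact hm'χ
  have hDσa : |((a + Ep.card : ℕ) : ℝ) / ((n + m' : ℕ) : ℝ) - pp| ≤ 2 * χ := by
    calc _ = |(((a + Ep.card : ℕ) : ℝ) / ((n + m' : ℕ) : ℝ) - (a : ℝ) / n) + ((a : ℝ) / n - pp)| := by ring_nf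
      _ ≤ |((a + Ep.card : ℕ) : ℝ) / ((n + m' : ℕ) : ℝ) - (a : ℝ) / n| + |(a : ℝ) / n - pp| := abs_add_le _ _
      _ ≤ χ + χ := add_le_add (le_trans hshA h2m') ha
      _ = 2 * χ := by ring
  have hDσb : |((b + Em.card : ℕ) : ℝ) / ((n + m' : ℕ) : ℝ) - pm| ≤ 2 * χ := by
    calc _ = |(((b + Em.card : ℕ) : ℝ) / ((n + m' : ℕ) : ℝ) - (b : ℝ) / n) + ((b : ℝ) / n - pm)| := by ring_nf
      _ ≤ |((b + Em.card : ℕ) : ℝ) / ((n + m' : ℕ) : ℝ) - (b : ℝ) / n| + |(b : ℝ) / n - pm| := abs_add_le _ _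
      _ ≤ χ + χ := add_le_add (le_trans hshB h2m') hb
      _ = 2 * χ := by ring
  have hDτa : |(a : ℝ) / n - pp| ≤ 2 * χ := by linarith [abs_nonneg ((a : ℝ) / n - pp)]
  have hDτb : |(b : ℝ) / n - pm| ≤ 2 * χ := by linarith [abs_nonneg ((b : ℝ) / n - pm)]
  have hmσ : g / 2 ≤ 1 - ((a + Ep.card : ℕ) : ℝ) / ((n + m' : ℕ) : ℝ) - ((b + Em.card : ℕ) : ℝ) / ((n + m' : ℕ) : ℝ) := by
    have h1 := (abs_le.1 hDσa).2
    have h2 := (abs_le.1 hDσb).2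
    linarith only [h1, h2, hχg, hg]
  have hmτ : g / 2 ≤ 1 - (a : ℝ) / n - (b : ℝ) / n := by linarith only [ha'.2, hb'.2, hχg, hg, hg0]
  have hpa : pm / 2 ≤ (a : ℝ) / n := by linarith only [ha'.1, hle, hχpm]
  have hpb : pm / 2 ≤ (b : ℝ) / n := by linarith only [hb'.1, hχpm]
  have hMa : μ * n ≤ a := le_trans (mul_le_mul_of_nonneg_right (min_le_left _ _) hn0.le) hpma
  have hMb : μ * n ≤ b := le_trans (mul_le_mul_of_nonneg_right (min_le_left _ _) hn0.le) hpmb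
  have hMg : μ * n ≤ (n : ℝ) - a - b - m' := by
    have h1 : μ * n ≤ g / 4 * n := mul_le_mul_of_nonneg_right (min_le_right _ _) hn0.le
    linarith only [h1, ha_hi, hb_hi, hm'g, hχn, hgn]
  have hμn : 0 < μ * n := mul_pos hμ0 hn0
  -- the counting-form lower bound
  have hmain := sum_slyZab_mul_prod_ge (n := n) (q := q) mv Ep Em h0a h0b h8Ja h4Jb hgap (pp := pp) (pm := pm) (D := 2 * χ)
    (p := pm / 2) (m := g / 2) (M := μ * n) (by linarith) (by linarith) hμn (by linarith) (by linarith) (by linarith only [hg0, hg])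
    hpa hpb hmσ hmτ hDσa hDσb hDτa hDτb hMa hMb hMg
  rw [← hJdef] at hmain
  refine le_trans ?_ hmain
  -- the bracket is at least `1 - ε`
  have hZ0 : 0 ≤ (∑ ω : (Fin q → Equiv.Perm (Fin (n + m'))) × Equiv.Perm (Fin n), ((slyZab n m' q a b Ep Em ω : ℕ) : ℝ)) :=
    Finset.sum_nonneg fun _ _ => Nat.cast_nonneg _
  have hpp1 : pp < 1 := by linarith
  have hpm1 : pm < 1 := by linarith
  have hr0 : 0 ≤ pp * pm / ((1 - pp) * (1 - pm)) := by
    have := sub_pos.2 hpp1; have := sub_pos.2 hpm1; have : 0 ≤ pp := by linarith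
    positivity
  have hP0 : 0 ≤ ∏ i : Fin k, ((((q : ℝ) ^ (2 * ((i : ℕ) + 1)) + q)) * (1 + (pp * pm / ((1 - pp) * (1 - pm))) ^ ((i : ℕ) + 1))) ^ (mv i) :=
    Finset.prod_nonneg fun i _ => by positivity
  have hbr : 1 - ε ≤ ((n.descFactorial J : ℕ) : ℝ) ^ 2 / ((n + m' : ℕ) : ℝ) ^ (2 * J) *
      Real.exp (-slyErrB J (2 * χ) (pm / 2) (g / 2) (μ * n) n) := by
    -- the ratio
    have r1 := descFactorial_sq_div_ge n m' J (by omega) (by omega)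
    have hNr : (0 : ℝ) < ((n + m' : ℕ) : ℝ) := by exact_mod_cast (show 0 < n + m' by omega)
    have hNn : (n : ℝ) ≤ ((n + m' : ℕ) : ℝ) := by exact_mod_cast Nat.le_add_right n m'
    have r2 : 2 * J * ((J : ℝ) + m') / ((n + m' : ℕ) : ℝ) ≤ ε / 4 := by
      have s1 : 2 * J * ((J : ℝ) + m') / ((n + m' : ℕ) : ℝ) ≤ 2 * J * ((J : ℝ) + m') / n :=
        div_le_div_of_nonneg_left (by positivity) hn0 hNn
      have s2 : 2 * J * ((J : ℝ) + m') / n ≤ 2 * (Jm : ℝ) ^ 2 * ((n : ℝ))⁻¹ + 2 * (Jm : ℝ) * (n : ℝ) ^ (-(9 / 10) : ℝ) := by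
        rw [div_eq_mul_inv]
        have hm'' : (m' : ℝ) ≤ (n : ℝ) ^ (-(9 / 10) : ℝ) * n := by rwa [hrpow] at hm'
        have hinv : (0 : ℝ) ≤ ((n : ℝ))⁻¹ := inv_nonneg.2 hn0.le
        have hr9 : (0 : ℝ) ≤ (n : ℝ) ^ (-(9 / 10) : ℝ) := Real.rpow_nonneg hn0.le _
        have hkey : (n : ℝ) ^ (-(9 / 10) : ℝ) * n * ((n : ℝ))⁻¹ = (n : ℝ) ^ (-(9 / 10) : ℝ) := by
          field_simp
        calc 2 * J * ((J : ℝ) + m') * ((n : ℝ))⁻¹ ≤ 2 * Jm * ((Jm : ℝ) + (n : ℝ) ^ (-(9 / 10) : ℝ) * n) * ((n : ℝ))⁻¹ := by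
              refine mul_le_mul_of_nonneg_right ?_ hinv
              exact mul_le_mul (by linarith only [hJr]) (add_le_add hJr hm'') (by positivity) (by positivity)
          _ = 2 * (Jm : ℝ) ^ 2 * ((n : ℝ))⁻¹ + 2 * (Jm : ℝ) * ((n : ℝ) ^ (-(9 / 10) : ℝ) * n * ((n : ℝ))⁻¹) := by ring
          _ = _ := by rw [hkey]
      have s3 : 2 * (Jm : ℝ) ^ 2 * ((n : ℝ))⁻¹ ≤ ε / 8 := by
        refine le_trans ?_ e4
        have hinv : (0 : ℝ) ≤ ((n : ℝ))⁻¹ := inv_nonneg.2 hn0.le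
        have : (0 : ℝ) ≤ (160 / μ + 8) * (Jm : ℝ) ^ 2 := by positivity
        exact mul_le_mul_of_nonneg_right (by linarith only [this]) hinv
      linarith only [r1, s1, s2, s3, e5]
    -- the error exponent
    have r3 : slyErrB J (2 * χ) (pm / 2) (g / 2) (μ * n) n ≤ ε / 2 := by
      refine le_trans (slyErrB_mono hJ (by linarith) (by linarith) (by linarith) hμn n) ?_
      unfold slyErrB
      have t1 : 26 * (Jm : ℝ) * (2 * χ) / (g / 2) + 2 * Jm * (2 * χ / (pm / 2)) = L * χ := by
        simp only [hL]; field_simp; ring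
      have t2 : 160 * (Jm : ℝ) ^ 2 / (μ * n) + 8 * (Jm : ℝ) ^ 2 / n ≤ ε / 8 := by
        have hinv : (0 : ℝ) ≤ ((n : ℝ))⁻¹ := inv_nonneg.2 hn0.le
        calc 160 * (Jm : ℝ) ^ 2 / (μ * n) + 8 * (Jm : ℝ) ^ 2 / n = ((160 / μ + 8) * (Jm : ℝ) ^ 2) * ((n : ℝ))⁻¹ := by
              field_simp
          _ ≤ ((160 / μ + 8) * (Jm : ℝ) ^ 2 + 2 * (Jm : ℝ) ^ 2) * ((n : ℝ))⁻¹ :=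
              mul_le_mul_of_nonneg_right (by linarith only [sq_nonneg (Jm : ℝ)]) hinv
          _ ≤ ε / 8 := e4
      linarith only [t1.le, t1.ge, t2, hLχ, hε]
    have r4 : 1 - ε / 2 ≤ Real.exp (-slyErrB J (2 * χ) (pm / 2) (g / 2) (μ * n) n) := by
      have := Real.add_one_le_exp (-slyErrB J (2 * χ) (pm / 2) (g / 2) (μ * n) n)
      linarith
    have r5 : 1 - ε / 4 ≤ ((n.descFactorial J : ℕ) : ℝ) ^ 2 / ((n + m' : ℕ) : ℝ) ^ (2 * J) := by linarith only [r1, r2]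
    by_cases hε1 : ε ≤ 1
    · calc 1 - ε ≤ (1 - ε / 4) * (1 - ε / 2) := by nlinarith only [sq_nonneg ε, hε.le]
        _ ≤ _ := mul_le_mul r5 r4 (by linarith only [hε1]) (by positivity)
    · have hε1' := not_le.1 hε1
      have : 0 ≤ ((n.descFactorial J : ℕ) : ℝ) ^ 2 / ((n + m' : ℕ) : ℝ) ^ (2 * J) *
          Real.exp (-slyErrB J (2 * χ) (pm / 2) (g / 2) (μ * n) n) := by positivity
      linarith
  calc (1 - ε) * (∑ ω : (Fin q → Equiv.Perm (Fin (n + m'))) × Equiv.Perm (Fin n), ((slyZab n m' q a b Ep Em ω : ℕ) : ℝ)) *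
        ∏ i : Fin k, ((((q : ℝ) ^ (2 * ((i : ℕ) + 1)) + q)) * (1 + (pp * pm / ((1 - pp) * (1 - pm))) ^ ((i : ℕ) + 1))) ^ (mv i)
      = (∑ ω : (Fin q → Equiv.Perm (Fin (n + m'))) × Equiv.Perm (Fin n), ((slyZab n m' q a b Ep Em ω : ℕ) : ℝ)) *
        (∏ i : Fin k, ((((q : ℝ) ^ (2 * ((i : ℕ) + 1)) + q)) * (1 + (pp * pm / ((1 - pp) * (1 - pm))) ^ ((i : ℕ) + 1))) ^ (mv i)) *
        (1 - ε) := by ring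
    _ ≤ _ := mul_le_mul_of_nonneg_left hbr (mul_nonneg hZ0 hP0)

end Final

end Literature.Computability.Complexity
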